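import Summits.HodgeConjecture.HodgeConjecture.Theses.HCCMUnconditional                  -- v4: the route (decls of record `HCCMUnconditional.HLiu418 ∕ H21 ∕ H413 ∕ HD3`)
import Summits.HodgeConjecture.HodgeConjecture.Theorems.HCCMUnconditionalH411            -- v4: `H411_proof` (item CLOSED, B-p19 p603824) — [Def 4.11] by name
import Summits.HodgeConjecture.HodgeConjecture.Theorems.HCCMUnconditionalHD1pp           -- v4: `HD1pp_proof` (item CLOSED, B-p01 p603347) — [Lem D.1 (1)] by name
import Summits.HodgeConjecture.CorCM.HypLiu418.A3Liu418EtaleItems                        -- v4: §EtaleItems of v3 IN TREE (A-p06 p598646) — replaces the local section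
import Summits.HodgeConjecture.CorCM.HypLiu418.A3Liu418AlbTransitionEpi                  -- v4: (I) `stubAlbTransitionEpi_holds` (A-p07 p599521)
import Summits.HodgeConjecture.CorCM.HypLiu418.A3Liu418HonestIsogenyDescent              -- v4: (D) `stubHonestIsogenyDescent_holds` (A-p12 p604826; B-p16 VI-4/VI-5)
import Summits.HodgeConjecture.CorCM.HypLiu418.A3Liu418LabelSeparation                   -- v4: (S) `stubGaloisLabelSeparation_byName_of_casselman_of_thm415` (A-p18)
import Summits.HodgeConjecture.CorCM.HypLiu418.A3Liu418NonIso                            -- v4: (N) `stubNonIso_of_hypD3_hypD1pp` (A-p08 p602107-era closure)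
import Summits.HodgeConjecture.CorCM.HypLiu418.A3Liu418BettiThetaModelAtPlace            -- v4: (P, at place) `bettiThetaModelAtPlace_of_hyp413_of_pinning` (A-p06 p600917)
import Summits.HodgeConjecture.CorCM.HypLiu418.A3Liu418PinBettiPinningAtPin              -- v4: (P, GAP 1) `pinBettiPinning_of_lemma24` (A-p18 p602555 ∕ p603007)
import Literature.NumberTheory.Automorphic.Liu2021.AppendixC.EtaleFaltingsIsotypic       -- v4: (F) `faltingsIsotypic_of_isInducedBy` (A-p17; conditional on VI-1 `faltings_tate_bijective`)
import Literature.AlgebraicGeometry.ShimuraVarieties.UnitaryShimuraCanonicalModelUnique  -- v4: row I-4 `canonicalModel_unique_printed` (off-place residual's named input)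
import Summits.HodgeConjecture.CorCM.HypLiu418.A3Liu418EpsRigidFaceTypes               -- v9: A-p19 p611602 — the III-11 binder Props `LocalTypeGaloisTwist` ∕ `CyclotomicUnitIsLocalNorm{Odd,Dyadic}` ∕ `PrescribedLocalSquareClass` BY NAME
import Summits.HodgeConjecture.CorCM.HypLiu418.A3Liu418EpsRigidAtFace   -- v9: A-p19 p614667 `epsRigidAtFace_of_localTwist` — III-11 `EpsRigidAtFace` DERIVED from the four binder Props
import Summits.HodgeConjecture.CorCM.HypLiu418.A3Liu418CyclotomicUnitIsLocalNormOdd   -- v9: A-p11 p615673 `cyclotomicUnitIsLocalNormOdd_holds` — slot CyclotomicUnitIsLocalNormOdd CLOSED BY NAME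
import Summits.HodgeConjecture.HodgeConjecture.Theorems.A3Liu418PrescribedLocalSquareClass   -- v9: A-p12 p612863 `prescribedLocalSquareClass_holds` — slot PrescribedLocalSquareClass CLOSED BY NAME
import Summits.HodgeConjecture.CorCM.HypLiu418.A3Liu418LocalTypeGaloisTwist   -- v10: B-p08 p618003 `localTypeGaloisTwist_holds` — slot LocalTypeGaloisTwist (row III-11a) CLOSED BY NAME
import Summits.HodgeConjecture.CorCM.HypLiu418.A3Liu418CyclotomicUnitIsLocalNormDyadic   -- v10: A-p11 g4 p618694 `cyclotomicUnitIsLocalNormDyadic_holds` — slot CyclotomicUnitIsLocalNormDyadic (row III-11c) CLOSED BY NAME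
import Summits.HodgeConjecture.CorCM.HypLiu418.A3Liu418PinBettiPinningOfLemma24Proj   -- v11: A-p18 C2 p614256 `pinBettiPinning_of_lemma24Proj` ∕ `stubBettiThetaModelOffPlace_of_h413_of_unique_of_lemma24Proj` ∕ `HypLiu418.HLiu418_of_facts_of_lemma24Proj` (hLp-form consumers)
import Literature.NumberTheory.Automorphic.Liu2021.Lemma24OfJacobianDimension   -- v11: A-p17 F6 p620156 `albanese_bettiOne_pullback_bijective_of_isProjectiveOver` = [Liu2021, Lem. 2.4 (1)] at projective smooth X, per-piece form (row III-0 CLOSED)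
import Summits.HodgeConjecture.HodgeConjecture.Theorems.HCCMUnconditionalHLiu418OfTwoFacts   -- v11: A-p18 p619779 `HLiu418_of_lemma24Proj_of_two_facts` — A-p18 closing head over the `hLp` binder (second audit example; F6 fed by name)
import Literature.NumberTheory.Automorphic.Liu2021.AppendixC.Thm415PinnedOfFrobenius   -- v12: A-p12 g4 ★ `thm415Pinned_of_frobenius` — III-9′(R0) «Frobenius-dense ⇒ all σ» CLOSED BY NAME
import Literature.NumberTheory.Automorphic.Liu2021.AppendixC.TowerMorphismLift   -- v15: T2 receptacle ★ p640334 `TowerMorphism` (A-p17) + K-b ★ p642283 `TowerMorphismLift` (A-p17): `Sec42Data.TowerHom`, `.toEtaleTowerHom`, `EtaleTowerHom.etPull`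
import Literature.NumberTheory.Automorphic.UnitaryGroupLevelTransport   -- v15: ★ `UnitaryGroup.finAdelicCongr` (frame change `R_B`) for the seesaw-source PIN (census k20, A-p16 g6)
import Literature.NumberTheory.Automorphic.UnitaryGroupDirectSumCarriers   -- v15: ★ `blockDiagFin` ∕ `finSum` ∕ `finiteAdelicForm` for the PIN's block-diagonal `U(V⋆) × U(V⋆^⊥) ↪ U(V)`
import Literature.NumberTheory.Automorphic.UnitaryGroupDirectSumCarriersFinite   -- v15: ★ `finAdelicBlockDiag` (A-p16 g6)
import Literature.NumberTheory.Automorphic.Liu2021.AppendixC.SeesawSource   -- v16: ★ carriers `SeesawSource` ∕ `Mult1OmegaHom` ∕ `SeesawSource.FrobeniusActsBy` ∕ `S34SomeSource` (B-typ02 g7) — local generic layer deleted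
import Literature.NumberTheory.Automorphic.Liu2021.AppendixC.OmegaHomPullback   -- v15: k19 ★ `towerRep_eq_smul_of_span_of_pull_ne_zero` (A-p18) — S5 CLOSED BY NAME
import HarnessLib
import Summits.HodgeConjecture.CorCM.HypLiu418.A3Liu418Items                            -- v5 (A-p19): §Items + datumC/SpaceIdent/CV/TV/UV/CarN IN TREE (p605885) — replaces :164–:271
import Summits.HodgeConjecture.CorCM.HypLiu418.A3Liu418MainGaloisGlue                   -- v5 (A-p19): (G) `stub_mainGaloisGlue_of` (p606438)
import Summits.HodgeConjecture.CorCM.HypLiu418.A3Liu418BettiThetaModelOffPlace   -- v6: A-p02 D4 p607116 `stubBettiThetaModelOffPlace_of_h413_of_unique_of_lemma24` (off-place P CLOSED BY NAME)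
import Literature.AlgebraicGeometry.ShimuraVarieties.UnitaryShimuraCanonicalModelUniqueProofs   -- v6: A-p07 g3 p607432 `canonicalModel_unique_printed_holds` (row I-4 DISCHARGED)
import Summits.HodgeConjecture.HodgeConjecture.Theorems.A3Liu418EtaleComparisonAtFace   -- v7: A-p16 p608142 `stubEtaleComparisonAtFace_holds` (row VI-2″ CLOSED AT THE FACE, over L1 p607309 + L2 p607861 + A-p18 p607148)
import Summits.HodgeConjecture.CorCM.HypLiu418.A3Liu418FaceTypes                       -- v8: A-p18 p608544 — the 15 face-closure Props + `EpsRigidAtFace` BY NAME (local copies deleted)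
import Summits.HodgeConjecture.HodgeConjecture.Theorems.HCCMUnconditionalHLiu418OfFacts      -- v8: A-p18 p608878 `HypLiu418.HLiu418_of_facts` — the by-name closing head (audit example below)
import Summits.HodgeConjecture.HodgeConjecture.Theorems.A3Liu418Mult1AtFace                -- v17: A-p09 k21 ★ p650508 `mult1AtFace_of_h413` — MULT1 CLOSED BY NAME from the route item `H413`
import Summits.HodgeConjecture.HodgeConjecture.Theorems.A3Liu418S34OfGS   -- v18: GS-8 ★ p690754 (A-p09) · v20: edition 2 ★ p706204 = HB bodies (A-p18 g8) + `section HeadsV20` `s34SomeSource_CV_of_GS'` ∕ `s34SomeSource_fourLe_of_GS'` (A-p09 g10) over ★ p705503 `Theorems/A3Liu418S34ClauseOneOfCurveRecords` (A-p17 g6) ← GS-3″ ★ p704480 `UnitaryShimuraCurveRecordOfEmbedding` v2 (A-p08 g9) — S34 CLOSED BY NAME, GS-3 DISCHARGED BY PROOF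
import Summits.HodgeConjecture.CorCM.HypLiu418.A3Liu418GSFrobeniusOfThmD6   -- v21 (v2y): GS-6 (β) ★ p748737 `frobeniusActsByGS_of_thmD6 (hD6 : thmD6OneCurveCUF) : frobeniusActsByGS` (S-op chain of record 2026-08-29: S-3b `A3Liu418GSCentralPlug` ed.4 ★ p745925 → `…CentralPlugTailCast` ★ p746502 → `…CentralPlugTail` ★ p747098 → `…FrobeniusOfThmD6Pieces` ★ p747619 → `…FrobeniusOfThmD6Fold` ★ p748442 → this module ★ p748737; cut A-p18 g10, filer A-p17 g8, fold A-p19, assembly A-p10, `chiSplittingFrameTransport_holds` A-p02; zero sockets) over ★ S-4α `A3Liu418GSThmD6OneCurve` (`thmD6OneCurveCUF`, declseg e57225827176fb89) — `stub_GS6` ↦ `stub_D6`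
import Summits.HodgeConjecture.CorCM.HypLiu418.A3Liu418GSFrobenius   -- v18: GS-6 ★ p689530 NAMED FACT `frobeniusActsByGS` (Summits-resident, director (P-Sum) 2026-08-29T00:05:40Z) — registered as `stub_GS6`
import Literature.AlgebraicGeometry.ShimuraVarieties.UnitaryBallH1RestrictionToSpecialCurves   -- v18: III-8′ ★ p648408 NAMED FACT `UnitaryBallUniformisationDatum.MR92Prop6Source` — registered as `stub_MR92Prop6Source` (row III-8 re-pointed)
import Literature.AlgebraicGeometry.ShimuraVarieties.UnitaryBallH1RestrictionToSpecialCurvesHolds   -- v19: III-8′ PROVED ★ p694505 `UnitaryBallUniformisationDatum.mr92Prop6Source` ∕ `mr92Prop6Source_forall` (A-p05 g9; tree sha16 09e2678c40990f42) — `stub_MR92Prop6Source` CLOSED BY NAME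
import Summits.HodgeConjecture.CorCM.HypLiu418.A3Liu418FaltingsIsotypicOfCMType   -- v22 (LINE T5′): (J2) ★ p732382 `stubFaltingsIsotypic_of_hF` (A-p03 g9) — the crux's Faltings slot from the `hF` binder at the faces
import Summits.HodgeConjecture.CorCM.HypLiu418.A3Liu418T5pAlbaneseCMType   -- v22 (LINE T5′): F3b ★ p732392 `hF_of_h413` (A-p09 g12) — the VI-1 socket's `hF` binder IS A THEOREM OF `H413` (CM-Albanese ∕ multiplicity-one road; generic capital ★ A″ p729674 · B p730114 · C p729662 · D p729888/p730425/p730790 · F1 p730473 · F2 p731193 · F3a p731387 · junction p730224)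


/-!
# `Lines/a3-liu418.lean` — crux skeleton for the binder `hLiu418` = `PrintedCitationHypotheses.HypLiu418` ([Liu 2021, Thm 4.18] AS PRINTED, GLOBAL, at the conjugate space's transported datum)

Cell `hodgecm-mathlib`, fan A, rung A-III (planner seat A-plan2).  TARGET BY NAME = the decl of record
`Summit.HodgeConjecture.CorCM.D2Bridge.MuKeyIdentLemD3DelRecConjOmegaEndT.PrintedCitationHypotheses.HypLiu418`
(`Summits/HodgeConjecture/CorCM/D2Bridge/PrintedCitationHypothesesT.lean` :59–:84) = `∀ hDel, <binder hLiu418 of the headline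
hc_cm_of_printed_citations_muKey_ident_lemD3_delRecConjOmegaT, ClosedPrintedMuKeyIdentLemD3DelRecConjOmegaT.lean :107–:127, verbatim>`;
the per-`hDel` body is restated here as `HLiu418 hDel` and `HypLiu418 ↔ ∀ hDel, HLiu418 hDel` holds by `Iff.rfl` (`hypLiu418_iff`, kernel conformance).

**v22 (A-plan1 g12 draft ∕ g13 writer, 2026-08-29T22:40Z; LINE T5′ — ROW VI-1 [Fal83] CLOSED BY DERIVATION FROM `H413` (director hodgecm-mathlib s155 ∕ s157 ∕ s158; road owner A-p09 g12, cone census `A-provers/A-p09/T5PRIME-CONE-CENSUS.A-p09g12.md`; junction A-p04 g11 ★ p730224 `Theorems.hF_of_isOfCMType_alb`; (J2) A-p03 g9 ★ p732382; F3b A-p09 g12 ★ p732392).** The `hF` binder of ★ `faltingsIsotypic_of_isInducedBy` — bijectivity of the Tate map for the FACE pair `(Alb X_K, A_μ(obj))` at every small level and every `obj ∈ 𝒜(ν)` — is supplied by `hF_of_h413 h413` ([Liu2021, Thm. 1.1 ∕ Cor. 4.20]-shaped, ≤ print: REF1 m09): `H413` ([Prop. 4.13] Betti theta decomposition at the pin,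 ranging over ALL of `PIN.H` with index `AdmTripleAll`) + ★ `isIrreducibleOrZero_rho_UV_of_hyp411 H411_proof` ([Def. 4.11]) + ★ `admTripleAll_UV_eq_of_equiv` (cross-`μ` non-isomorphy) + ★ `stubHonestIsogenyDescent_holds` make `End⁰(Alb X_K)`'s Hodge action multiplicity-free, hence `Alb(X_K) ⊗ ℂ` of CM type (★ `isOfCMType_of_multiplicityFree_of_isHodgeMorphismOne`, leaf B), and [Fal83 §5 Kor. 1] FOR CM PAIRS is the tree theorem ★ `hF_of_isOfCMType_alb` ((N9) via [Shimura1998, Thm. 18.6]); so `stub_faltingsIsotypic` takes the binder `h413` (already a binder of the head) and the §T5 block LEAVES THIS CONE: `HypEllPowerTower`, the registered fact-level `stub_hypEllPowerTower`, R1 `stub_realization_of_hypEllPowerTower`, R2 `stub_faltings_of_realization` and the derived general statement `stub_faltings_tate_bijective` (Faltings for ALL pairs over number fields — not needed by [Thm. 4.18]) stay on record in the T5 workfile `Cruxes/HLiu418/Lines/faltings_isogeny.lean` (v5) only; import `TateHypEllPowerTower` dropped; the two legacy audit `example`s (v8 ∕ v11 #2) that fed general [Fal83] to A-p18's older heads are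 dropped with it (the v4 `closes` audit stays).  REGISTERED `sorry`s: 2 → 1 = {`stub_D6`} ([Liu2021, Thm. D.6 (1)] one-curve, C′).  Head `HLiu418_proof (h21) (h413) (hD3)` statement unchanged (one token: `stub_faltingsIsotypic` ↦ `stub_faltingsIsotypic h413`).  Books (director): INVENTORY row VI-1 «CLOSED BY DERIVATION from H413 (+ ★ H411 ∕ ★ HD1″ as theorems)», fan-B unproved 12 → 11, citation surface −[Faltings1983].  HC_CM is proved only modulo the 7 printed citations until rung 0 closes.**

**v21 (A-plan1 g11 draft ∕ g13 writer, 2026-08-29T22:40Z — written to the tree in ONE edition together with v22 (director hodgecm-mathlib s165 (2) «β»; v21 certified by paste: `A-plan/gs6-glue/V21-REGISTRY.bypaste.A-p10g9.lean` 2dfefe8dbfdc334b); v2y — GS-6 RE-POINTED TO [Liu2021, Thm. D.6 (1)] FOR ONE CURVE by the (β) decomposition road (director hodgecm-mathlib s115 ∕ s135 ∕ s139; A-plan2 `A-plan/GS6-HOIST-SPEC.md`, `A-plan/GS6-PHASEB-PLACEMENT.md`; wave-1 ★ 14 DEF + ≥ 19 PROOF files, wave-2 ★ files ending in S-4α ★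 p726363 `CorCM/HypLiu418/A3Liu418GSThmD6OneCurve` (`thmD6OneCurveCUF`, declseg sha16 e57225827176fb89; A-p17) and S-4 ★ p748737 `CorCM/HypLiu418/A3Liu418GSFrobeniusOfThmD6` `frobeniusActsByGS_of_thmD6 (hD6 : thmD6OneCurveCUF) : frobeniusActsByGS` (landed as the S-op chain S-3b `A3Liu418GSCentralPlug` ed.4 ★ p745925 (deny-list import `HarnessLib.Audit.LibrarySuggestionsDenyListCorCM`, director s190) → `A3Liu418GSCentralPlugTailCast` ★ p746502 → `A3Liu418GSCentralPlugTail` ★ p747098 → `A3Liu418GSFrobeniusOfThmD6Pieces` ★ p747619 → `A3Liu418GSFrobeniusOfThmD6Fold` ★ p748442 → `A3Liu418GSFrobeniusOfThmD6` ★ p748737; cut A-p18 g10 ∕ filer A-p17 g8 ∕ skeleton A-p17 ∕ §F fold A-p19 ∕ assembly A-p10 ∕ `chiSplittingFrameTransport_holds` A-p02; ZERO sockets, axioms trio)): `stub_GS6 : frobeniusActsByGS` REPLACED by `stub_D6 : thmD6OneCurveCUF` + the derived `theorem gs6_of_D6 : frobeniusActsByGS := frobeniusActsByGS_of_thmD6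 stub_D6`; `stub_S34` takes `gs6_of_D6` where it took `stub_GS6` (one token); ONE new import; lit1 (g6) CLASS L1 docstring riders «§4.3 (l. 21xx)» → «§4.2 (FJcycle.tex l. 21xx; print pp. 49–50)» ×5 (docstring-only).  Registered text of every other item UNCHANGED (`S34AtFace` v15, `FacePinData`, `HLiu418_proof` head byte-identical).  REGISTERED SORRIES AFTER v21 = 2: `stub_hypEllPowerTower` (T5, VI-1) and `stub_D6` (III-14′, [Liu2021, Thm. D.6 (1)] for `Sh(U(J⋆))` alone; print proof §D.4 pp. 139–140).  Books: fan-B row III-14 (GS-6, tower form) closes by proof modulo III-14′ (one curve); unproved printed inputs of the line 2 → 2 with strictly smaller print depth.  HC_CM is proved only modulo the 7 printed citations until rung 0 closes.**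

**v20 (A-plan1 g9, 2026-08-29T07:35Z; GS-3 RETIRED BY PROOF — road (ii) of the GS programme (director hodgecm-mathlib s10x; A-plan2 g8 `A-plan/GS-PROGRAMME.md`): GS-3″ HEAD ★ p704480 `Literature/AlgebraicGeometry/ShimuraVarieties/UnitaryShimuraCurveRecordOfEmbedding.lean` v2 `UnitaryCanonicalModel.exists_recordSystemGS_of_recordSystem` (A-p08 g9; over L3.1–L3.7 ★ A-p04/A-p09/A-p10/A-p11/A-p13/A-p14/A-p16, (F-A) ★ p697452/p702039, F-INJ ★ p702630) → sibling leaf ★ p705503 `Theorems/A3Liu418S34ClauseOneOfCurveRecords` primed clause-(1) head `exists_seesawSourceGS_etPull_comp_ne_zero'` (A-p17 g6) → GS-8 edition 2 ★ p706204 `Theorems/A3Liu418S34OfGS` `s34SomeSource_CV_of_GS'` (A-p09 g10; HB bodies A-p18 g8)): `stub_GS3` DELETED.**  `theorem stub_S34 : S34AtFace := … s34SomeSource_CV_of_GS' stub_MR92Prop6Source stub_GS6 …` — the v15 registered text of `S34AtFace` and every other statement token-identical to v19; the registered fact-level slot `stub_GS3 : exists_recordSystemGS` ([Deligne 1979, 2.7.21]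 + [Milne 2005, Thm. 13.6] record system of the unitary Shimura CURVE) is no longer an input of this line: the GS record system is CONSTRUCTED from the rank-3 canonical-model record system `exists_recordSystem_of_printed hDel` (route binder `canonicalModel_exists_printed`, unchanged) by embedding the special curves; ONE import dropped (`UnitaryShimuraCurveCanonicalModelExists`, the NAMED FACT stays in Literature as a citation). REGISTERED SORRIES AFTER v20 = 2: `stub_hypEllPowerTower` (T5, VI-1 [Fal83]), `stub_GS6` (GS-6 NAMED FACT ★ p689530). Head `HLiu418_proof (h21) (h413) (hD3)`, gate-shape `closes` example and both AUDIT examples unchanged. HC_CM is proved only modulo the 7 printed citations until rung 0 closes.**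

**v19 (A-plan1 g8, 2026-08-29T04:08Z; III-8′ PROVED — A-p05 g9 ★ p694505 `Literature/AlgebraicGeometry/ShimuraVarieties/UnitaryBallH1RestrictionToSpecialCurvesHolds.lean` (tree sha16 09e2678c40990f42) over his ★ p693275 `UnitaryBallRationalSubconeDensity` + ★ p693682 `UnitaryBallConeFormPullback` and A-p14 g8 ★ p692731 `UnitaryBallUniformisationLocalSection`): `stub_MR92Prop6Source` CLOSED BY NAME.**  `theorem stub_MR92Prop6Source : ∀ {X} (D : UnitaryBallUniformisationDatum 2 X), D.MR92Prop6Source := fun D => D.mr92Prop6Source` — the v18 registered fact-level slot (row III-8′, [MR92, §5 Prop. 6 ∕ Lemma A ∕ Lemma B] as used in [Liu 2021] proof of Thm. 4.15 l. 2212 + fn. 9) is now a THEOREM of the tree (Hodge `(1,0)`∕`(0,1)` bookkeeping + density of the `E`-rational sub-cone + the cone-field chain rule; axioms trio); registered text of every other item UNCHANGED (`S34AtFace` v15, `stub_S34` v18 closer byte-identical, `FacePinData`, `HLiu418_proof` head); ONE new import. REGISTERED SORRIES AFTER v19 = 3: `stub_hypEllPowerTower` (T5), `stub_GS3` (GS-3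 NAMED FACT ★ p688907), `stub_GS6` (GS-6 NAMED FACT ★ p689530). Books: fan-B row III-8′ closes by proof (director's fold); HC_CM is proved only modulo the printed citations until rung 0 closes.**

**v18 (A-plan1 g8, 2026-08-29T02:50Z; E-GS EDITION (director hodgecm-mathlib s93 ∕ (P-Sum) 2026-08-29T00:05:40Z ∕ order of record 00:46:46Z): (b) ★ p683305 `CorCM/HypLiu418/A3Liu418GSSeesawSource` (A-p17) → GS-3 ★ p688907 `UnitaryCanonicalModel.exists_recordSystemGS` → GS-6 ★ p689530 `frobeniusActsByGS` → F6 ★ p689695 `Theorems/A3Liu418S34ClauseOneOfGS` (A-p17) → GS-8 ★ p690754 `Theorems/A3Liu418S34OfGS` (A-p09)): S34 CLOSED BY NAME.**  `theorem stub_S34 : S34AtFace := by intro …; exact s34SomeSource_CV_of_GS stub_GS3 stub_MR92Prop6Source stub_GS6 … (FacePin hDel F V Φ) (mkPin packing)` — the v15 registered text of `S34AtFace` and every other statement token-identical to v17; imports + 4; head `HLiu418_proof (h21) (h413) (hD3)` and both AUDIT examples unchanged.  THREE NEW REGISTERED FACT-LEVEL STUBS (NOT offered to provers): `stub_GS3 :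 exists_recordSystemGS` (fan-B row GS-3, GENERIC), `stub_MR92Prop6Source : ∀ {X} (D : UnitaryBallUniformisationDatum 2 X), D.MR92Prop6Source` (row III-8 re-pointed to the SOURCE form ★ p648408), `stub_GS6 : frobeniusActsByGS` (fan-B row GS-6, GENERIC, Summits-resident).  REGISTERED `sorry`s 2 → 4 = {`stub_hypEllPowerTower` (VI-1 [Fal83]), `stub_GS3`, `stub_MR92Prop6Source`, `stub_GS6`} — ALL FACT-LEVEL; no prover-closable stub remains on this line.  Reading of record: hLiu418 ⇐ {VI-1, GS-3, III-8′, GS-6} + `H21` ∕ `H413` ∕ `HD3`; floor v10 untouched.  HC_CM is proved only modulo the 7 printed citations until rung 0 closes.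

**v17 (A-plan1 g6, 2026-08-28T17:05Z; k21 ★ p650508 `Theorems/A3Liu418Mult1AtFace.lean` (A-p09 g5; twins A-p01 g3, A-p12 g4 slot 021483bb; director g6 s81 (2) KcPaste fallback edition while the p645003 olean is wedged)): MULT1 CLOSED BY NAME.**  `theorem stub_MULT1 : H413 → Mult1AtFace := fun h413 => mult1AtFace_of_h413 h413` — the v15d registered slot filled from the route item `H413` ([Prop 4.13]); imports + 1; every statement token-identical to v16; head `HLiu418_proof (h21) (h413) (hD3)` and both AUDIT examples unchanged.  REGISTERED `sorry`s 3 → 2 = {`stub_hypEllPowerTower` (VI-1 [Fal83], fact-level E), `stub_S34` (III-9′(S) GS-programme residual: III-8′ ★ p648408 `MR92Prop6Source`, GS-2 carrier `UnitaryShimuraCurveRecord` (B-typ02), GS-3 ∕ GS-6 not opened this shift — director s80 (4))}.  Reading of record: hLiu418 ⇐ {VI-1, S34} + `H21` ∕ `H413` ∕ `HD3`; floor v10 untouched (books-neutral).  HC_CM is proved only modulo the 7 printed citations until rung 0 closes.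

**v16 (A-plan1 g6, 2026-08-28T16:40Z; T2 carriers ★ p646662 `Literature/NumberTheory/Automorphic/Liu2021/AppendixC/SeesawSource.lean` (B-typ02 g7, commit 052dcde382dc); A-plan2 g5 GS FINDING F6 16:18:11Z + `A-plan/GS-PROGRAMME.md` (dossier of record for the `stub_S34` residual, director g6 s80); director g6 RULING s82 «P′ rides in v16 with `--carriers-import`»; pen decision 16:20:56Z): CARRIERS BY IMPORT + PIN P′.**  (a) The four generic T2 carrier declarations `SeesawSource` ∕ `Mult1OmegaHom` ∕ `SeesawSource.FrobeniusActsBy` ∕ `S34SomeSource` are now the ★ Literature declarations of `…Liu2021.AppendixC` (statements token-identical to v15's local layer, 504 = 504 tokens, B-typ02 census), the local copies are DELETED; the generic glue `thm415Frobenius_of_split`, `S5Transfer`, the face layer and every stub stay here, texts token-identical up to the provenance of those four constants.  (b) PIN P′: `FacePinData.eG : Gₛ ≃ₜ* U(J⋆)(𝔸_{F⁺,f})` (v15: `… × U(J⊥)(𝔸_{F⁺,f})`) and `φ_pin : φ (eG.symm u) = R_B (finAdelicBlockDiag 2 1 J⋆ J⊥ (u, 1))` — the seesaw SOURCE GROUP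 IS `U(V⋆)` ALONE as in print (l. 2193, l. 2203–2208; App. D `G = Res U(V⋆)`, so [Thm D.6 (1)] p. 132 is verbatim-anchorable on the source and the GS programme is the literal `3 ↦ 2` twin of ★ `Record ∕ RecordSystem`, no Künneth step); `Jstar Jperp B hB hpos` kept; `FacePin` ∕ `Mult1AtFace` ∕ `S34AtFace` NAMES, the proved glue `thm415FrobeniusAtFace_of_split` and the registered texts of `stub_hypEllPowerTower` ∕ `stub_MULT1 : H413 → Mult1AtFace` unchanged; `stub_S34 : S34AtFace`'s registered signature is the same TEXT over the re-pinned `FacePin` (one constant's body changed: `FacePinData`) — consumer-free, so the re-pin is free today (s82 (2)).  Costume door still shut: `EtaleTowerHom.refl` would need `U(H_V)(𝔸_f) ≃ₜ* U(J⋆)(𝔸_f)` with `eG.symm = R_B ∘ blockdiag(·,1)`, which is not surjective.  REGISTERED `sorry`s 3 = {`stub_hypEllPowerTower`, `stub_MULT1`, `stub_S34`} (k21 `mult1AtFace_of_h413` closes `stub_MULT1` by name on its ★: 3 → 2); imports + 1; head `HLiu418_proof (h21) (h413) (hD3)` and both AUDIT examples unchanged; floor v10 untouched (books-neutral).  HC_CM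 is proved only modulo the 7 printed citations until rung 0 closes.

**v15d (A-plan1 g6, 2026-08-28T16:20Z; director g6 RULING s77 (2) ∕ s79 (2) «`stub_MULT1` REGISTERED TEXT = `H413 → Mult1AtFace`»; A-p09 g5 ⚠ 15:28:36Z + slot evidence 15:43:48Z; s77 (1): rows #62∕#63 LAPSE, `stub_S34` booked as ONE fact-cluster residual «GS programme»; T2 carriers B-typ02 g7 FILED p646662 `Liu2021/AppendixC/SeesawSource.lean`): MULT1 KEYED ON THE ROUTE ITEM `H413`.**  ONE re-typing — `stub_MULT1 : …Theses.HCCMUnconditional.H413 → Mult1AtFace` (v15's closed text `Mult1AtFace` had no hypothesis-free closer this shift: [Prop 4.13] IS the open sibling item `H413`, already a hypothesis of the head) — and the `h413` threading as explicit binders on the three DERIVED theorems `stub_S_thm415Frobenius (h413)`, `stub_thm415AtFace (h413)`, `stub_galoisLabelSeparation_of (h21) (h413)` (conclusions unchanged; the head's proof passes `h413`).  REGISTERED `sorry`s 3 = {`stub_hypEllPowerTower` (VI-1), `stub_MULT1 : H413 → Mult1AtFace` (closer of record k21 = A-p09 `Theorems/A3Liu418Mult1AtFace.lean :: mult1AtFace_of_h413`,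 by name on its ★ ⇒ 3 → 2), `stub_S34` (GS-programme residual)}; `stub_hypEllPowerTower` ∕ `stub_S34` ∕ `stub_S5` texts and every other v15 statement token-identical; head `HLiu418_proof (h21) (h413) (hD3)` and both AUDIT `example` STATEMENTS unchanged (their proof terms pass `h413` to `stub_thm415AtFace`); floor v10 untouched (books-neutral: floor cost of MULT1 = 0, `h413` ⇐ rows III-dictE ∕ III-J3a ∕ III-occ ★ p638274).  HC_CM is proved only modulo the 7 printed citations until rung 0 closes.

**v15 (A-plan1 g6, 2026-08-28T15:55Z; director g4 RULING s71 «(S)-SPLIT GO, design (β) per-`f` transfer under MULT1»; T2 receptacle block ★ 4/4 = T2-R3 p640334 `TowerMorphism` · K-b p642283 `TowerMorphismLift` (A-p17) · K-a p642343 `TowerMorphismRefl` (A-p16) · K-c p642878 `TowerMorphismComp` (A-p18); k19 `OmegaHomPullback` ★ p644483 (A-p18, commit e939a0430c5a); census k20 `A-provers/A-p16/CENSUS-k20-face-group-dictionary.md` 7720d0506b3b911c; B-typ02 g7 typer faithfulness census 15:24:46Z (F1)–(F4) ADOPTED: (F3) existential merge): ROW III-9′(S) SPLIT ALONG THE PRINTED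 PROOF l. 2185–2213.**  The registered fact-level XXL stub `stub_S_thm415Frobenius : Thm415FrobeniusAtFace` becomes a DERIVED theorem `:= thm415FrobeniusAtFace_of_split stub_MULT1 stub_S34 stub_S5` (name + statement kept, so `thm415AtFace_of_R0_S`, the (S)-consumer and the head are byte-identical) over THREE new REGISTERED stubs typed in §T2 below and TWO kernel-checked glue theorems (`thm415Frobenius_of_split` generic: zero Hom-space ⇒ `S := ∅`, else `f₀ ≠ 0` → S34 source `s` with its finite set → S5 transfer → MULT1 scaling; `thm415FrobeniusAtFace_of_split` at the face): MULT1 `stub_MULT1 : Mult1AtFace` — any two elements of `Hom_{ℚ_ℓ^{ac}[𝔾]}(ι∘ω(μ,ε,χ), ℚ_ℓ^{ac} ⊗ H¹_ét(A_∞))` are proportional ([Prop 4.13] multiplicity one, l. 2185); NOT a floor row and NOT a new fact: its closing plan is a BRIDGE from row III-J3a ★ `Liu2021.Prop413Data.multiplicity_le_one_printed` (floor binder `hJ3a`, Betti, `ℂ`, `Module.rank ℂ (IntertwiningMap (P.rhoAt t) (P.rhoB τ')) ≤ 1`) through the Betti–étale comparison ★ (row VI-2″ `stubEtaleComparisonAtFace_holds`)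 and the `uniformOmegaRep`∕`Prop413Data.rhoAt` identification — exact vocabulary delta censused in `A-plan/LIU415-SPEC.md` §8 (director s71 (1): the floor must not acquire a 7th binder restating `hJ3a`) · S34 `stub_S34 : S34AtFace` (FACT XXL, EXISTENTIAL = junk-free and print-faithful, B-typ02 (F3): every `f ≠ 0` has non-zero pull-back `(1 ⊗ etPull_M) ∘ f` to SOME pinned seesaw source `s` — [MR92 Prop 6 ∕ Lemma B, dim-2 variant] exactly as invoked by [Liu21] proof of Thm 4.15 p. 51 l. 2212 + fn. 9, the `E`-morphism of canonical models [Milne05 Thm 13.6] being `s.M` — ON WHICH (`s.FrobeniusActsBy`) the arithmetic Frobenii act on the SOURCE Hom-space by `ι(μ^{alg}(ϖ_v))⁻¹` cofinitely — [Liu21] App. D Thm D.6 (1) in the `(1,0)` branch of Rem D.5 via Prop D.8 ∕ Cor D.9 after [Car86], [Raj00 Thm 1]; an `∃` over carrier data is TRUE as soon as the ONE geometric source satisfies it (v15a's separate `∀ s`-form S4 over-claimed relative to print: B-typ02 (F1)–(F2)); orientation G4 explicit; fan-B rows #62∕#63 reserved (director s74) for its D-0014 named-fact file) · S5 `stub_S5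 : S5Transfer` (THEOREM, generic: per-`f` transfer of a Galois scalar UP an étale tower morphism under «`f` spans» + «pull `f ≠ 0`»; = k19 ★ p644483 `towerRep_eq_smul_of_pull` + 6 lines, CLOSED BY NAME in this edition from ★ `towerRep_eq_smul_of_span_of_pull_ne_zero`).  THE PIN (B-p19 receptacle pattern «interface + separate existence», junk-excluding, census k20): a seesaw source is a `structure SeesawSource ℭ T ℓ Pin` = an abstract Appendix-C datum `ℭₛ` with Hecke translates, `φ : Gₛ →* G` continuous with `φ(K₀ₛ) ≤ K₀`, a `Sec42Data.TowerHom` `M`, an induced étale Hecke datum `Xₛ`, and `pin : Pin ℭₛ φ`; at the face `Pin := FacePin` = `Nonempty (FacePinData F V Gₛ φ)`: a `2 + 1` Gram splitting `ᵗ(cB)·H_V·B = J⋆ ⊕ J⊥` with `J⊥` totally positive, `eG : Gₛ ≃ₜ* U(J⋆)(𝔸_{F⁺,f}) × U(J⊥)(𝔸_{F⁺,f})` and `φ ∘ eG⁻¹ = R_B ∘ blockdiag` (★ `finAdelicCongr`, ★ `finAdelicBlockDiag`; `(ℭ_V).G = U(H_V)(𝔸_{F⁺,f})` by `rfl`, `Model.honestP5Of_G`)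 — so `EtaleTowerHom.refl` cannot witness S34 (costume door closed: its group is `U(H_V)(𝔸_f)`, not the pinned product); `PropC5Data.n` alone would not pin (unconstrained field).  No residual ∀-exposure remains (the v15a `∀ s` form is gone); S34 is FACT-level with a REF1 reading audit owed (director s71 (2) ∕ s74).  REGISTERED `sorry`s: 2 → 3 = {`stub_hypEllPowerTower` (VI-1), `stub_MULT1`, `stub_S34`} ≤ 7; imports + 5; every v14 `theorem` statement token-identical; head `HLiu418_proof (h21) (h413) (hD3)` and both AUDIT examples unchanged; floor v10 untouched (books-neutral).  HC_CM is proved only modulo the 7 printed citations until rung 0 closes.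

**v14 (A-plan1 g6, 2026-08-28T13:40Z; director g4 RULING s48 (T5 R3) + s54 + s58 (2); pen-split (A) ACCEPTED by A-plan2 g3 13:10:57Z — A-plan1 g6 holds this registry; sub-skeleton `Cruxes/HLiu418/Lines/faltings_isogeny.lean` v3 2d8869bc49003700 WRITTEN 13:33:07Z commit 792a599fbc0e): THE §T5 JUNCTION MOVES TO LITERATURE.**  `HypEllPowerTower P ℓ` is now BY DEFINITION the Literature predicate `Literature.AlgebraicGeometry.Motives.AbelianVariety.tateHypEllPowerTower P ℓ` (R3 ★ `Motives/TateHypEllPowerTower.lean`, A-plan1 draft 5523a8fd filed by A-p16 p635344 · A-p17 p635359; its body is the v13 ∀-text token for token, so the registered citation of `stub_hypEllPowerTower` did not move — `Iff.rfl` certificate `hypEllPowerTower_iff_text` in `faltings_isogeny.lean` v3); R1 `stub_realization_of_hypEllPowerTower` is closed BY NAME through R3's `AbelianVariety.tateSubspaceRealization_of_tateHypEllPowerTower` (= ★ p632350 `tateSubspaceRealization_of_ellPowerTower_numberField`); imports: the two R1/R2 files ↦ the R3 file (which imports both).  Every `theorem` statement token-identical to v13 (in particular the REGISTERED texts of `stub_hypEllPowerTower`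 and `stub_S_thm415Frobenius` and the derived `stub_faltings_tate_bijective` = the floor's `hFal` text); REGISTERED `sorry`s 2 → 2; head `HLiu418_proof (h21) (h413) (hD3)` and both AUDIT examples unchanged; books-neutral.  Consequence: banked leaves toward the residual (A-p04 §6.4 bricks, the CM-elliptic first rung) and the candidate floor edition E-VI-1 «`hFal` ↦ `∀ P ℓ, tateHypEllPowerTower P ℓ`» (director's call, FALTINGS-SPEC §7; bridge = R3 `faltings_tate_bijective_of_forall_tateHypEllPowerTower`) now key on ONE Literature name with zero adapters.  HC_CM is proved only modulo the 7 printed citations until rung 0 closes.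

**v13 (A-plan2 g2, 2026-08-28T12:32Z; director g4 BATCH 122 (T5) «A-plan2 folds stubs 3 → 2 → 1 into the 24832 registry after v12»; SPEC `A-plan/FALTINGS-SPEC.md` 3dda62426d419ef0 (A-plan1 g5); sub-skeleton `Cruxes/HLiu418/Lines/faltings_isogeny.lean` v1 8290a4dc33d2d9a0 (A-plan1, REF1 pre-cert ★ PASS 12:04:20Z); rungs A-p16 g6 R1 ★ p632350 + R2 ★ p632258): ROW VI-1 RE-KEYED PRINT-TOWARD.**  The registered fact-level stub `stub_faltings_tate_bijective` ([Fal83 §5 Satz 4 ∕ Kor. 1] for all pairs) becomes a DERIVED theorem (name + statement kept = the floor's `hFal` text) over the §T5 block (A-plan1's texts VERBATIM, re-homed in this namespace): `HypEllPowerTower` (Tate's Hyp along ℓ-power towers, sequence form) · REGISTERED fact-level `stub_hypEllPowerTower` ([Fal83] §3 Satz 1 + §4 Satz 2 + §5 ¶1; print-implied by Satz 6 + Zarhin ∕ Milne IV 1.1; NOT offered to provers — heights ∕ p-divisible groups ∕ semistable reduction absent) · R1 `stub_realization_of_hypEllPowerTower` CLOSED BY NAME (`tateSubspaceRealization_of_ellPowerTower_numberField`)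 · R2 `stub_faltings_of_realization` CLOSED BY NAME (`faltings_tate_bijective_of_tateSubspaceRealization`) (A-plan1's Finiteness-I comparison theorems `hypEllPowerTower_of_finitenessI` ∕ `VI1_of_finitenessI` stay in his workfile, outside this cone).  REGISTERED `sorry`s: 2 → 2 = {`stub_hypEllPowerTower` (VI-1, fact-level E), `stub_S_thm415Frobenius` (III-9′(S), fact-level XXL)}; imports + 2 (A-p16's R1/R2 files); every v12 `theorem` statement token-identical; head `HLiu418_proof (h21) (h413) (hD3)` and both AUDIT examples unchanged; books-neutral (VI-1's one citation ↦ one citation, weaker and print-toward).  HC_CM is proved only modulo the 7 printed citations until rung 0 closes.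

**v12 (A-plan2 g2, 2026-08-28T12:12Z; director g3 BATCH 117 (T2) / g4 BATCH 120 «LIU415-SPEC → a3_liu418 v12»; SPEC `A-plan/LIU415-SPEC.md`; READFIRST A-p09 g4 4d7c9bdbe8d47e4d + A-p12 g4 e82ca0b0b8b80975; A-p12 g4 report-first `Thm415PinnedOfFrobenius` 1ace9bfdb503f604): ROW III-9′ SPLIT ALONG LIU'S SEAM.**  The registered fact-level stub `stub_thm415AtFace : Thm415AtFace` ([Thm 4.15] PINNED, B-typ04) becomes a DERIVED theorem `:= thm415AtFace_of_R0_S stub_R0_frobeniusToPinned stub_S_thm415Frobenius` (name + statement kept) over TWO new registered stubs typed in §T2 below: III-9′(S) `stub_S_thm415Frobenius : Thm415FrobeniusAtFace` = [Thm 4.15] PROPER in FROBENIUS FORM (for all `v` outside a finite set every arithmetic Frobenius at `𝔓 ∣ v` acts on `Hom_{ℚ_ℓ^{ac}[𝔾]}(ι∘ω(μ,ε,χ), ℚ_ℓ^{ac} ⊗ H¹_ét(A_∞))` by `ι(μ^{alg}(ϖ_v))⁻¹`; no `A_μ`/`i_μ` binders; FACT-LEVEL XXL, printed proof S1–S5)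 and III-9′(R0) `stub_R0_frobeniusToPinned : R0FrobeniusToPinned` = «Frobenius-dense ⇒ all σ» (+ [Def 4.5 (2)] Frobenius form) ⇒ pinned, for every datum — CLOSED BY NAME in this edition by A-p12 g4 ★ `thm415Pinned_of_frobenius` (new import `…AppendixC.Thm415PinnedOfFrobenius`).  The face glue `thm415AtFace_of_R0_S` is kernel-checked here (the CM hypothesis discharged by `obj ∈ 𝒜(ν)` via `Carriers.ofPolDR` + ★ `IsCMCharacterMuAlgHecke.isCMCharacterMuAlg`).  REGISTERED `sorry`s: 2 → 2 = {`stub_faltings_tate_bijective` (VI-1), `stub_S_thm415Frobenius` (III-9′(S))} (III-9′(R0) closed by name); imports + 1 (A-p12's R0 file); every v11 `theorem` statement token-identical; head `HLiu418_proof (h21) (h413) (hD3)` and both AUDIT examples unchanged.  HC_CM is proved only modulo the 7 printed citations until rung 0 closes.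

**v11 (A-plan2 g2, 2026-08-28T09:21Z; director g2 BATCH 61 (b) / g3 «III-0 close → a3_liu418 III-0 edition»; text announced STATUS 07:59:57Z): ROW III-0 LEAVES THE CONE.**  The registered fact-level stub `stub_albanese_bettiOne_pullback_bijective : Liu2021.albanese_bettiOne_pullback_bijective` ([Lem 2.4] AS TYPED, all smooth `X`) is DELETED — its two consumers now run BY NAME on the PROJECTIVE per-piece form `hLp` that A-p17's F6 proves outright (`Lemma24OfJacobianDimension.albanese_bettiOne_pullback_bijective_of_isProjectiveOver`, p620156) through A-p18's C2 (p614256): `stub_pinBettiPinning := pinBettiPinning_of_lemma24Proj ‹F6›` (statement unchanged) and `stub_bettiThetaModel_offPlace : H413 → canonicalModel_unique_printed → StubBettiThetaModelOffPlace := fun h413 hU => stubBettiThetaModelOffPlace_of_h413_of_unique_of_lemma24Proj ‹F6› h413 hU` (the ONE statement change of this edition: the third arrow `albanese_bettiOne_pullback_bijective →` is dropped; A-p02's pinning twin p613630 ∕ A-p06's `HLiu418_of_facts_of_pinning` p616383 are the equivalent road); the head's off-place call loses that argument; the AUDIT `example` is re-pointed to `HypLiu418.HLiu418_of_facts_of_lemma24Proj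 ‹F6› (fun A B ℓ => ‹VI-1› A B ℓ) ‹III-9′› ‹III-11› h21 h413 hD3` and a second one to A-p18's III-0-free head `HLiu418_of_lemma24Proj_of_two_facts` (p619779).  REGISTERED `sorry`s: 3 → 2 (the III-0 slot is gone; nothing else moves); every other `theorem` statement token-identical to v10; zero mathematical content added — the Literature fact as typed stays an unproved named Prop that nothing in the cone cites.  HC_CM is proved only modulo the 7 printed citations until rung 0 closes.

**v10 (A-plan2 g2, 2026-08-28T08:54Z; director g2 BATCH 61 (b) by-name editions on triggers; announced STATUS 08:42:46Z + 08:45:42Z («−III-11»: fold III-11a + III-11c); B-p08 ★ p618003 / A-p11 g4 ★ p618694 (ACCEPTED 08:52Z)): SLOT(S) CLOSED BY NAME — row III-11a `stub_localTypeGaloisTwist : LocalTypeGaloisTwist := Summit.HodgeConjecture.CorCM.Lines.A3Liu418.localTypeGaloisTwist_holds` (B-p08 ★ p618003; [BH06 §33–34; Liu21 Lem. D.1 (3)] local-type Galois twist, chain P3a/P4/P3b/(iv)/(β)/layers/harness all ★) · row III-11c `stub_cyclotomicUnitIsLocalNormDyadic : CyclotomicUnitIsLocalNormDyadic := Summit.HodgeConjecture.CorCM.HypLiu418.cyclotomicUnitIsLocalNormDyadic_holds`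 (A-p11 g4 ★ p618694; [Neukirch V.3.6/V.1.4 at p = 2] dyadic cyclotomic-unit norm via the LCFT-free projection formula at 2 for completions `hilbertSymbol_normCompat_adicCompletion_two` (A-p13 ★ p618033; crew B-p21 (O), B-p04 (N), A-p13 (L1/L2))). ⇒ the DERIVED `stub_epsRigidAtFace := epsRigidAtFace_of_localTwist stub_localTypeGaloisTwist stub_cyclotomicUnitIsLocalNormOdd stub_cyclotomicUnitIsLocalNormDyadic stub_prescribedLocalSquareClass` is now SORRY-FREE inside the skeleton: ROW III-11 ([Liu21 Thm 4.18 (3)] ε-rigidity at the face) LEAVES THE CONE — all four binder slots closed by name (11a B-p08 p618003 · 11b A-p11 p615673 · 11c A-p11 g4 p618694 · 11d A-p12 p612863; P7 A-p19 p614667), the same term as A-p19's announced `epsRigidAtFace_holds` up to δ.  No statement changes; every `theorem` statement token-identical to v9; REGISTERED `sorry`s: 5 → 3.  Zero mathematical content added.  HC_CM is proved only modulo the 7 printed citations until rung 0 closes.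

**v9 (A-plan2 g2, 2026-08-28T08:25Z; director g2 BATCH 61 (b) «a3_liu418 v9 after A-p19's `A3Liu418EpsRigidFaceTypes` files: III-11 stub re-pointed to the closed Props; III-0 text unchanged»; text announced STATUS 07:18:10Z): III-11 RE-POINTED TO ITS BINDER FACTS (rows III-11a–d).**  `import …HypLiu418.A3Liu418EpsRigidFaceTypes` (A-p19 p611602, same namespace) + `import A3Liu418EpsRigidAtFace` (A-p19 ★ p614667); the v8 registered residual `stub_epsRigidAtFace : EpsRigidAtFace := sorry` is now DERIVED — `stub_epsRigidAtFace := epsRigidAtFace_of_localTwist stub_localTypeGaloisTwist stub_cyclotomicUnitIsLocalNormOdd stub_cyclotomicUnitIsLocalNormDyadic stub_prescribedLocalSquareClass` (name kept, so `stub_mainGaloisGlue` and everything below is byte-identical) — over 4 FACT-LEVEL SLOTS typed BY NAME on A-p19's closed Props (INVENTORY v4.1 rows III-11a–d, director BATCH 64): `stub_localTypeGaloisTwist : LocalTypeGaloisTwist` (III-11a) · `stub_cyclotomicUnitIsLocalNormOdd : CyclotomicUnitIsLocalNormOdd` (III-11b) · `stub_cyclotomicUnitIsLocalNormDyadic : CyclotomicUnitIsLocalNormDyadic`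 (III-11c) · `stub_prescribedLocalSquareClass : PrescribedLocalSquareClass` (III-11d); row III-11 itself is now DERIVED by P7 and leaves the floor — reading of record: hLiu418 ⇐ {III-0, VI-1, III-9′, III-11a–d} + H21 ∕ H413 ∕ HD3; CLOSED BY NAME at this edition: `stub_cyclotomicUnitIsLocalNormOdd := cyclotomicUnitIsLocalNormOdd_holds` (A-p11 p615673), `stub_prescribedLocalSquareClass := prescribedLocalSquareClass_holds` (A-p12 p612863).  REGISTERED `sorry`s (5): `stub_albanese_bettiOne_pullback_bijective` (III-0) · `stub_faltings_tate_bijective` (VI-1) · `stub_thm415AtFace` (III-9′) · `stub_localTypeGaloisTwist` (III-11a) · `stub_cyclotomicUnitIsLocalNormDyadic` (III-11c).  III-0 ∕ VI-1 ∕ III-9′ texts UNCHANGED; head `HLiu418_proof (h21) (h413) (hD3)` and the v8 AUDIT `example` vs `HypLiu418.HLiu418_of_facts` unchanged; every v8 `theorem` statement token-identical; zero mathematical content added or removed.  HC_CM is proved only modulo the 7 printed citations until rung 0 closes.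

**v8 (A-plan2 g1, 2026-08-28T06:15:53Z): FACE TYPES BY NAME + AUDIT AGAINST THE CLOSING HEAD.**  The 15 face-closure Props (v7 :206–:412) are DELETED here and IMPORTED from A-p18's
`A3Liu418FaceTypes.lean` (★ p608544, same FQNs; token-identical); `stub_epsRigidAtFace : EpsRigidAtFace` (the new tree name; same Expr as v5–v7's spelled ∀-type); a kernel AUDIT
`example` shows A-p18's closing head `HypLiu418.HLiu418_of_facts` (★ p608878) fed with THIS file's four registered stubs + the three route items proves `HCCMUnconditional.HLiu418` —
i.e. the skeleton and the closing head agree on the residual set {III-0, VI-1, III-9′, III-11}.  REGISTERED `sorry`s (4, unchanged): `stub_albanese_bettiOne_pullback_bijective` ·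
`stub_faltings_tate_bijective` · `stub_thm415AtFace` · `stub_epsRigidAtFace`.  Head `HLiu418_proof` unchanged.  When the four rows land: `HLiu418_proof h21 h413 hD3 :=
HLiu418_of_facts ‹III-0› (fun A B ℓ => ‹VI-1› A B ℓ) ‹III-9′› ‹III-11› h21 h413 hD3` (A-p18; A-p12 g3 slot test (B) de3fa300854c77b7 GREEN).  HC_CM is proved only modulo the 7 printed citations until rung 0 closes.

**v7 (A-plan2 g1, 2026-08-28T05:57:42Z): row VI-2″ CLOSED BY NAME AT THE FACE** — `stub_etaleComparisonAtFace := stubEtaleComparisonAtFace_holds` (A-p16 ★ p608142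
`Theorems/A3Liu418EtaleComparisonAtFace.lean`, ns `…CorCM.Lines.A3Liu418`, over his L1 p607309 `EtaleHeckeDatumOfTranslates` + L2 p607861 `EtaleBettiComparisonHolds` + A-p18 p607148;
slot-tested by A-p12 fe3e7ab0428586a2: 5 → 4).  REGISTERED `sorry`s (4, ALL GENUINE PRINTED RESIDUALS): `stub_albanese_bettiOne_pullback_bijective` (III-0 [Liu21 Lem 2.4]; A-p07 g3
lead + A-p08 g2) · `stub_faltings_tate_bijective` (VI-1 [Fal83]) · `stub_thm415AtFace` (III-9′ [Liu21 Thm 4.15 = MR92] at the face) · `stub_epsRigidAtFace` (III-11 [Liu21 Thm 4.18 (3)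
∕ BH06 41.2 (2)] at the face; A-p12 read-first 05:52:46Z: genuine residual, no `_holds` road tonight).  Head `HLiu418_proof` unchanged.  HC_CM is proved only modulo the 7 printed
citations until rung 0 closes.

**v6 (A-plan2 g1, 2026-08-28T05:45:06Z; director g2 BATCH 15/16): off-place P and row I-4 CLOSED BY NAME.**  `stub_bettiThetaModel_offPlace :=
stubBettiThetaModelOffPlace_of_h413_of_unique_of_lemma24` (A-p02 ★ D4 p607116 `CorCM/HypLiu418/A3Liu418BettiThetaModelOffPlace.lean` — the hLiu418 off-place END COMPLETE: FILE A p605776 (A-p08)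
· FILE B p605947 (A-p02) · FILE C p606168/p606638 (A-p12) · D1 p606534 (A-p02) · D2 p606431 (A-p17) · D4 p607116 (A-p02); slot-tested by A-p02 48b11a7d4ae3549c and A-p12) and
`stub_canonicalModel_unique_printed := UnitaryCanonicalModel.canonicalModel_unique_printed_holds` (A-p07 g3 ★ p607432
`Literature/AlgebraicGeometry/ShimuraVarieties/UnitaryShimuraCanonicalModelUniqueProofs.lean`, row I-4 DISCHARGED, fan-B debt −1).  REGISTERED `sorry`s (5, ALL FACT-LEVEL or
face-closed facts): `stub_albanese_bettiOne_pullback_bijective` (III-0; A-p08 g2 sizing) · `stub_etaleComparisonAtFace` (VI-2″ at the face; A-p16 L1 p607309 + A-p18 p607148, A-p12 face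
closing file `A3Liu418EtaleComparisonAtFace.lean`) · `stub_faltings_tate_bijective` (VI-1) · `stub_thm415AtFace` (III-9′ = Liu Thm 4.15 at the face; earlier paragraphs say III-6)
· `stub_epsRigidAtFace` (III-11 at the face).  A-p18's announced `A3Liu418FaceTypes.lean` (the 16 face-closure Props :181–:385 + `EpsRigidAtFace`, same FQNs) and
`Theorems/HCCMUnconditionalHLiu418OfFacts.lean` (`HLiu418_of_facts`) are COMPATIBLE: when (A) lands, v7 imports it and drops the local Props exactly as v5 did with §Items.
Head `HLiu418_proof` unchanged.  HC_CM is proved only modulo the 7 printed citations until rung 0 closes.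

**v5 (A-plan2 g1, 2026-08-28T05:37:42Z; director g2 05:07:01Z pen queue (ii); text = A-p19's draft `A-provers/A-p19/a3-liu418.v5-draft.lean` df6c07e026615e14 + this paragraph).**
(G) IS CLOSED BY NAME: A-p19 ★ p606438 `Summits/HodgeConjecture/CorCM/HypLiu418/A3Liu418MainGaloisGlue.lean` `stub_mainGaloisGlue_of (h21) (hGT)` (G1 isotypic cut-out
p603097 + G2 Galois blocks of ε-rigidity p600635 + G3 transport p603328; object of `𝒜(ν)` from `h21`), so `stub_mainGaloisGlue := fun h21 => stub_mainGaloisGlue_of h21 stub_epsRigidAtFace`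
modulo the NEW registered A-side residual `stub_epsRigidAtFace` = row III-11 (G2): ε-RIGIDITY UNDER GALOIS TWIST `Thm418Data.EpsRigidUnderGaloisTwist` (B-typ04's named
predicate p600012) at `V`'s own relabelled one-object rest `D₀ = toThm418Data ℭ_V ((muConj 𝕌_V).rest t_ν)`, ∀-closed over the face prefix.  §Items (`MainGalois`,
`LevelInvariants`, `NonIso`, `thm418AsPrinted_of_items`, `items_of_thm418AsPrinted`, `datumC`, `SpaceIdent`) and the face abbreviations `CV` `TV` `UV` `CarN` (v4 :164–:273)
are now the TREE decls of A-p19 ★ p605885 `CorCM/HypLiu418/A3Liu418Items.lean` (same namespace, byte-for-byte) and are DELETED here (imported).  REGISTERED `sorry`s (7):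
`stub_albanese_bettiOne_pullback_bijective` (III-0, fact-level) · `stub_canonicalModel_unique_printed` (I-4, fact-level) · `stub_bettiThetaModel_offPlace` (P off place; A-p02 LEAD,
D1 p606534 / D2 A-p17→released / D3 A-p12 p606168 / D4 A-p02) · `stub_etaleComparisonAtFace` (VI-2″, fact-level) · `stub_faltings_tate_bijective` (VI-1, fact-level) ·
`stub_thm415AtFace` (III-6; A-p08 g2 O3 sizing) · `stub_epsRigidAtFace` (III-11 at the face; NEW).  Head `HLiu418_proof` unchanged.  Zero mathematical content added or removed.
HC_CM is proved only modulo the 7 printed citations until rung 0 closes.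

**v4 (RE-FILE 2026-08-28 ~04:50Z, crux workfile `Cruxes/HLiu418/Lines/a3_liu418.lean` of item `stmt-HodgeConjecture-24832`; route
`route-HodgeConjecture-HCCMUnconditional`).**  GATE-SHAPE HEAD: `HLiu418_proof (h21 : HCCMUnconditional.H21) (h413 : HCCMUnconditional.H413)
(hD3 : HCCMUnconditional.HD3) : HCCMUnconditional.HLiu418` — the route's OTHER items as the only hypotheses (`H411`, `HD1pp` are CLOSED and enter BY NAME as
`Theorems.H411_proof` ∕ `Theorems.HD1pp_proof`); the local copies of the pack decls (`HLiu418`, `HypLiu418`, `Hyp411`, `HypD3`, `HypD1pp`) and the local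
§EtaleItems are DELETED in favour of the decls of record (`PrintedCitationHypotheses.*`, `A3Liu418EtaleItems`).  SLOTS CLOSED BY NAME since v3: (I)
`stubAlbTransitionEpi_holds`, (D) `stubHonestIsogenyDescent_holds` (unconditional: VI-4 ∕ VI-5 ∕ VI-6 proved), (S) `stubGaloisLabelSeparation_byName_of_casselman_of_thm415 h21
stub_thm415AtFace`, (N) `stubNonIso_of_hypD3_hypD1pp hD3 HD1pp_proof`, (F) `faltingsIsotypic_of_isInducedBy` modulo the named fact VI-1 (Faltings), (P) CUT AT ∕ OFF
PLACE: at place (`(mk ι₁).embedding = ι₁`) `bettiThetaModelAtPlace_of_hyp413_of_pinning h413 stub_pinBettiPinning` with GAP 1 `stub_pinBettiPinning :=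
pinBettiPinning_of_lemma24 stub_albanese_bettiOne_pullback_bijective` (row III-0 by name); off place = the registered residual `stub_bettiThetaModel_offPlace :
H413 → canonicalModel_unique_printed → albanese_bettiOne_pullback_bijective → StubBettiThetaModelOffPlace` (OWNERS director g2 04:36:01Z: A-p08 LEAD ∕ A-p02 ∕ A-p12;
the B2 ∕ frame-change ∕ B3 ∕ I-4 chain: `RecordSystem.exists_conj_alongConj`, `RecordSystem.exists_of_frame`, `RecordSystem.nonempty_iso_of_canonicalModel_unique`, then transport of the pinning
along the model isomorphism; row I-4 enters HERE and only here — REF1 04:23:22Z accounting).  R-a: `StubBettiThetaModel` ∕ `StubEtaleBettiModel` carry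
`(hΦ : ι₁ ∈ Φ.1)`.  REGISTERED `sorry`s (7 = the shred ceiling): FACT-LEVEL residuals `stub_albanese_bettiOne_pullback_bijective` (III-0, [Liu21 Lem 2.4]),
`stub_canonicalModel_unique_printed` (I-4, [Del71 5.5]), `stub_faltings_tate_bijective` (VI-1, [Fal83]), `stub_etaleComparisonAtFace` (VI-2″, [SGA4 XI 4.4] at the
face), `stub_thm415AtFace` (III-6, [Liu21 Thm 4.15] = [MR92]) and the two A-side residuals `stub_bettiThetaModel_offPlace` (OFF-PLACE P; A-p08 LEAD ∕ A-p02 ∕ A-p12),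
`stub_mainGaloisGlue : H21 → StubMainGaloisGlue` (G; A-p19: `stub_mainGaloisGlue_of (h21) (hGT : EpsRigidAtFace)` over p603097 ∕ p603328 ∕ p600635 — when it
lands, v5 re-cuts G to the residual `stub_epsRigidAtFace` ([BH06 41.2 (2)] + Lem D.1 (3)) and the count stays 7).  AUDIT (`example` at the end): with this
line the route's `closes` needs `hDel`, `h21`, `h413`, `hD3` only.  HC_CM is proved only modulo the 7 printed citations until rung 0 closes.

`sorry` occurs only in the three registered `stub_*`.  **HC_CM is proved only modulo the 7 printed citations (`hDel`, `h21`, `hLiu418`, `h411`, `h413`, `hD3`, `hD1''`)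
until rung 0 closes; this file removes none of them — it cuts `hLiu418` into named stubs.**

**v2 (RE-FILE 2026-08-28, director ACK 01:21:26Z of A-p08's RE-FILE PROPOSAL 01:21:13Z).**  Item (2) of [Liu Thm 4.18] (pairwise non-isomorphy) IS the
content of the A-IV rows — [Lem D.1 (3)] separation (`hD3`) + [Lem D.1 (1)] non-vanishing (`hD1''`) at `V`'s own family, moved to the conjugate space by
transport — and A-p08 has DERIVED it from them (work file `A3Liu418NonIso.lean` sha16 3f8b686b49abe222, farm rc 0, 0 sorry; generic part filed p593138
`Literature/NumberTheory/Automorphic/Liu2021/Thm418TransportNonIso.lean`; the Summits closure lands with STMT-IDS).  So v2 RESHAPES `stub_nonIso` to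
`HypD3 → HypD1pp → StubNonIso` (the two pack decls threaded BY NAME — here as character-identical local copies `HypD3` ∕ `HypD1pp` while the farm snapshot
has the pack unbuilt) and re-threads the head: `HypLiu418_of : StubMainGalois → StubLevelInvariants → (HypD3 → HypD1pp → StubNonIso) → HypD3 → HypD1pp →
HypLiu418`.  `HypD3`, `HypD1pp` are binders of the certificate in their own right, discharged by their own lines (`Lines/a4-liuD3.lean`, `Lines/a4-liuD1pp.lean` +
fan B's B-IV); neither consumes `HypLiu418`, so there is no cycle, and item (2) now costs NOTHING beyond A-IV.  `stub_levelInvariants` (A-p07's pin) and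
`stub_mainGalois` are byte-identical to v1 (131d50a2abf5e9b8); the v2 glued split of `stub_mainGalois` over B-typ04's rows is a separate re-file.

## The datum, unfolded (this IS the H-R3 orientation check)

`HLiu418 hDel` says: for every Galois CM field `F` (`6 ≤ [F:ℚ]`), `ι₁`, hermitian 3-space `V`, real scalar `a`, CM type `Φ ∋ ι₁`,
conjugate-symplectic weight-one `ν`, every Deligne record `R'` of the CONJUGATE space `c(V)` whose model functor IS `V`'s tower re-indexed
along `K ↦ c(K)` (`hR'`), and every CM type `Φ'`: `Thm418AsPrinted D′` where `D′ = datumC … = (toThm418Data ℭ_V ((muConj 𝕌_V).rest t_ν)).transport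
G₂ φ Eps (epsOf δ′) Chi (𝕌_{V^c}.omega ν hν) (𝕌_{V^c}.rho ν hν)`.  Reading the fields of `Thm418Data.transport` / `toThm418Data` / `restOne`:
* `D′.G = G₂ = U(V^c)(𝔸_{F⁺,f})` natively (`(sec42DataOf h isoOf F ι₁ V̂.conj Φ').G`); `φ = (HermSpace3.adelicFinConj V̂).symm : G₂ ≃ₜ* G₁ = U(V)(𝔸_{F⁺,f})` is `g ↦ ḡ`.
* `D′.n = 3`, `D′.μ = ν`, `M_ν = fieldOfValues K ν`; `D′.Obj = 𝒜(ν)` = `ObjOne (AlgHom.id ℚ K) ι₁ hν hw 𝒞(ν)` (Def 4.5 CM data of record, `V`-INDEPENDENT ✔).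
* theta side: `D′.Eps/Chi` = the tree carriers `Def411WeilCarriers.Eps E⁺ (imagUnitSq K)` / `Chi E⁺ K c`, `D′.epsOf = epsOf … (2·imagUnit K)⁻¹` (Liu's own `δ′`),
  `D′.omega/rho` = the CONJUGATE space's OWN [Def 4.11] family `uniformOmegaRep h F ι₁ V̂.conj Φ' e₁ (frameD V) … (iotaVConj …) δ′ (repConj F r)` at label `ν`,
  on `V`'s real diagonal frame (`diagonal_frameD_map_complexConj`) — print WORLD C for `(𝕍^(c), ν)` ✔ (space face: R10 ✔ + R6 ✔, cf. the docstring of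
  `MuConjIdent.thm418AsPrinted_muConj_rest_iff_transport_hermConj`).
* Ω side: `D′.Ω = ΩOne ℭ_V … = DirectLimit_{K ≤ K3(V)} ℚ ⊗ℤ Hom(Alb X_K(V,Φ-record), A_ν)`, `D′.res K' = ℭ_V.res (levelOf (K'.map φ))`,
  `D′.rhoΩ = (𝕋_V.rhoΩOne …).comp φ` — i.e. `V`'s Albanese tower and `V`'s Hecke translates READ THROUGH `g ↦ ḡ`.  Print wants `Ω(ν)` of `𝕍^(c)`'s OWN tower
  `{Sh(𝕍^(c))_{K'}}`: `ℭ_V.X K = M_K(V) ⊗_{K,c} K` (the c-TWIST of `V`'s Deligne record, `MuConjIdentificationSpace.lean` :160) and the binder `(R', hR')`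
  (inhabited for every `hDel` by R6 `MuConjIdent.exists_recordSystemConj_X_sec42DataOf_levelOf_eq` from RSCONJ `RecordSystemConj.exists_conj`) says this functor
  IS the model functor of a Deligne record of `(c(H), ι₁, T̄)`: the tautological ball quotient of `(cH)^{ι₁}`-negative lines at levels `c(K)`.  Hecke compatibility
  (`V`'s translate by `φ k = c⁻¹k` = `c(V)`'s native translate by `k`; residue (L) = [Del79] 2.1.4 ∕ [Mil05] 13.6) is NOT displayed by `hR'` (inclusions only) but is
  KERNEL-AVAILABLE for the RSCONJ witness: `RecordSystemConj.exists_conj_hecke` (`HComp/RecordSystemConjHecke.lean` :286).  So `D′` is `c(V)`-native on both sides.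
* ORIENTATION (memo `A-plan/A3-ORIENTATION.md`, sha16 4f5f05722c61a5cf): relative to the tree's `c(V)`-tower the row is [Thm 4.18] AS PRINTED for `(𝕍^(c), ν)` token for
  token; the one external sign — whether print's `Sh(G, h♭_{c(V),ι₁})(ℂ)` (FJcycle l. 4590–4596, `h♭(z) = diag(1,1,z/z̄)`) is the TAUTOLOGICAL `(cH)^{ι₁}`-ball (⇒ MATCHES)
  or its conjugate ([Del79] 1.1.1+1.1.14 literal: `T^{1,0} = 𝔭⁺ = Hom(W₊,W₋)` ⇒ the row is print for `𝕍` with theta label `ν ↦ νᶜ`, MIRROR) — is KNOWN-SOFT-SPOTS S1 and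
  bites ONLY inside `stub_mainGalois` (its «why it might fail» line); `stub_levelInvariants` ∕ `stub_nonIso` are orientation-insensitive.

## Strategy (Liu's printed proof of Thm 4.18, `FJcycle.tex` l. 2247–2290, run for `(𝕍^(c), ν)` at `D′`)

¶1 (l. 2247–2254): by Rem 4.17 / Prop 4.6(1) pass to a small level; the map `α` of (4.3) pulled back along the `ν`-isotypic projection is injective with image the
`ν^{alg}`-isotypic part of `H¹` — FALTINGS' isogeny theorem [Fal83] (`Literature.AlgebraicGeometry.Motives.faltings_tate_bijective`) + Betti/ℓ-adic comparison + Def 4.5(2)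
(`A_ν` has CM by `M_ν` with type `Φ_ν`).  ¶2 (l. 2256–2272): decompose `H¹_{B,τ'}(Sh_∞) ⊗ ℂ` by Prop 4.13 (here: for `𝕍^(c)`, binder `h413` of the headline read at `c(V)`)
and cut out the `ν`-part by the Galois action of Thm 4.15 [MR92 Prop 6] ⇒ main isomorphism + item (3) (Galois stability of the `ε`-blocks, local Langlands for `GL₁`,
[BH06 §41.2 (2)]).  ¶3 (l. 2274–2290): item (1) = Galois descent of ¶1 at finite level `K` (invariants = `Ω(ν)^K`); item (2) = the `ω(ν,ε,χ)` are pairwise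
non-isomorphic: Lem D.1 (1)+(3) [GR90 5.1.4] place by place + weak approximation — in the tree: `Liu2021.hsep_of_lemD1AsPrinted`,
`Def411WeilCarriers.forall_localMu_eq_of_equiv_of_lemD1AsPrintedI`, `eq_of_forall_localMu_toHeckeCharacter_eq`, `Def411WeilCarriersTripleSeparation` /
`UniformOmegaTripleSep` (the A-IV rows `hD3`/`hD1''` read at the conjugate family `𝕌_{V^c}`; `iotaVConj` is onto).

CUT (printed-item granularity; the composition `hLiu418_of` is a real proof): `stub_mainGalois` = main iso + (3) (they share the isomorphism `Φ`, so they are ONE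
stub), `stub_levelInvariants` = (1), `stub_nonIso` = (2).  The three item predicates `MainGalois / LevelInvariants / NonIso` are generic over `Thm418Data` —
INTERFACE statements to be moved verbatim to `Literature/NumberTheory/Automorphic/Liu2021/` by fan B (they only re-cut `Thm418AsPrinted`).

WHY THIS LINE: it is the author's own proof at the author's own granularity, every deeper input is already a NAMED tree fact or a displayed headline row
(`faltings_tate_bijective`, `h413`, Thm 4.15 = `LiuAlbaneseCMDatum.Thm415`-family, `hD3`/`hD1''`), and the cut isolates the single non-displayed print point
(Hecke compatibility under `hR'`) inside one stub instead of spreading it.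
[cite: Liu2021, Thm 4.18 + proof (arXiv:2102.11518, FJcycle.tex l. 2232–2290); Rem 4.17; Prop 4.13; Thm 4.15; Lem D.1]
[cite: Faltings1983] [cite: BushnellHenniart2006, §41.2] [cite: MurtyRamakrishnan1992, Prop 6, Lemma 1] [cite: GelbartRogawski1990, Prop 5.1.4]

## v3 (RE-FILE 2026-08-28 — director 01:25:43Z (I)(D) + CAPACITY (5) «glued split of `stub_mainGalois`, each piece a seat»)

* item (1): `stub_levelInvariants` is now the THEOREM `stub_levelInvariants_of` from two registered AG sub-stubs `stub_albTransitionEpi` (row VI-3, A-p07's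
  IFACE-ROW (I) verbatim: every `Alb_{u^{K'}_K}` is an epimorphism) and `stub_honestIsogenyDescent` (row VI-4, (D): `T_V.IsogenyDescent`), composed by A-p07's landed
  `levelInvariants_transport_of_epi_of_isogenyDescent` (p593390) BY NAME.
* item (2): `stub_nonIso` is CLOSED by A-p08's `stubNonIso_of_hypD3_hypD1pp` (p593829, `Summits/HodgeConjecture/CorCM/HypLiu418/A3Liu418NonIso.lean`); the farm snapshot
  does not build that module yet, so the sorried slot stays with the one-line fill recorded in the card.
* MAIN + (3): `stub_mainGalois` is now the THEOREM `stub_mainGalois_of` from the ℓ-ADIC SPLIT of Liu's printed proof (l. 2245–2272) run at `V`'s OWN §4.2 datum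
  `ℭ_V` (no re-instantiation of `c(V)` is needed: `D′`'s `Ω ∕ H¹` side IS `ℭ_V`'s Albanese tower seen through `φ`), over B-typ04's carriers
  (`Sec42Data.etaleH1Tower ∕ towerRep ∕ EtaleHeckeDatum ∕ BettiComparison`, `cmEigenline ∕ galoisH1Bar ∕ omegaHom`, named fact `Thm415Pinned`):
  `stub_bettiThetaModel` (fan B + the A-side pinning junction, row III-4 at the Albanese tower: a complex Betti tower module PINNED to the levels `H¹(Alb X_K ×_{τ'} ℂ)`
  (B-typ04 `BettiPinning`) with the [Prop 4.13] theta decomposition over ALL weight-one admissible labelled triples, multiplicity one; the étale Hecke datum INDUCED by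
  the Albanese translates (`IsInducedBy`) and its Betti comparison then come from B-typ04's NAMED FACT `exists_etaleHeckeDatum_with_bettiComparison` (p595473) BY NAME —
  head hypothesis `EtaleComparisonAtFace`, theorem `stub_etaleBettiModel_of`), `stub_faltingsIsotypic` (fan A:
  `ℂ ⊗_{M_ν} Ω(ν) ≅ Hom_{Γ_E}(ℚ_ℓ^{ac}·α_ν, ℚ_ℓ^{ac} ⊗ H¹_ét(A_∞))`, `𝔾`-equivariantly — Faltings + the CM line), `stub_galoisLabelSeparation` (labels `μ′ ≠ ν`
  carry a Galois character different from `α_ν`'s — Thm 4.15 at `μ′` + injectivity of `μ ↦ μ^{alg}`), `stub_mainGaloisGlue` (fan A: the `ν^{alg}`-isotypic cut-out,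
  item (3), and the transport `D₀ ↦ D′` along `MuConjIdent ∕ HComp.OmegaConj`), with [Thm 4.15] entering the head BY NAME as the hypothesis `Thm415AtFace`
  (typ04's `Thm415Pinned` instantiated at `(ℭ_V, muConj 𝕌_V, ν, A_ν, i_ν)` — THIS instantiation now carries the orientation sign S1 of A3-ORIENTATION §3, isolated
  from everything else) and [Def 4.11] as the pack decl `Hyp411` (local character-identical copy, as `HypD3 ∕ HypD1pp`).
  Registered stubs v3: 7 (`albTransitionEpi` M, `honestIsogenyDescent` M–L, `bettiThetaModel` L–XL (B), `faltingsIsotypic` L–XL, `galoisLabelSeparation` L,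
  `mainGaloisGlue` L–XL, `nonIso` CLOSED-pending-build); `StubMainGalois ∕ StubLevelInvariants ∕ StubNonIso ∕ HypLiu418 ∕ HypD3 ∕ HypD1pp` byte-identical to v2.
-/

set_option autoImplicit false

noncomputable section

namespace Summit.HodgeConjecture.CorCM.Lines.A3Liu418

open scoped TensorProduct Matrix
open NumberField NumberField.InfinitePlace
open HodgeCM.Model HodgeCM.Model.LiuIndex HodgeCM.Model.TowerCarrier
open HodgeCM.Literature.Theta.LiuAlbaneseModuleDatum.D2Bridge (HcmPieces)
open Summit.HodgeConjecture.CorCM.Model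
open Literature.AlgebraicGeometry.Motives (CMType)
open Literature.AlgebraicGeometry.HodgeTheory Literature.NumberTheory.Automorphic.PicardCM
open Literature.AlgebraicGeometry.ShimuraVarieties.UnitaryCanonicalModel
open Literature.NumberTheory.ComplexMultiplication
open Literature.NumberTheory.Automorphic
open Literature.NumberTheory.Automorphic.IdeleClassGroup (toHeckeCharacter isUnitary_toHeckeCharacter galConj)
open Literature.NumberTheory.Automorphic.Liu2021 Literature.NumberTheory.Automorphic.Liu2021.AppendixC
open Literature.NumberTheory.Automorphic.Liu2021.AppendixC.RestOne
open Literature.NumberTheory.Automorphic.Liu2021.Def411WeilCarriers (lineOf locF Rep)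
open Summit.HodgeConjecture.CorCM.Transposition.OmegaTransport (realUnit)
open HodgeCM.Model.ArchSideTerm (e₁)
open Literature.NumberTheory.GelbartRogawski1991 Literature.NumberTheory.GelbartRogawski1991.UnitaryDualPair
open Literature.NumberTheory.GelbartRogawski1991.UnitaryDualPair.LocalSplitting (localMu norm_localMu continuous_localMu localMu_toLocalRing_eq_one_iff
  eq_of_forall_localMu_toHeckeCharacter_eq)
open Literature.RepresentationTheory Literature.RepresentationTheory.Liu2021
open Summit.HodgeConjecture.CorCM.Transposition
open Summit.HodgeConjecture.CorCM.D2Bridge.AdapterMuConj (muConj prop413AsPrinted_muConj def411_muConj nontrivial_omegaAt_muConj_rest)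
open Summit.HodgeConjecture.CorCM.D2Bridge.MuKeyIdentEnd (hc_cm_of_printed_citations_muKey_ident)
open Summit.HodgeConjecture.CorCM.D2Bridge.MuKeyIdentLemD3End
open Summit.HodgeConjecture.CorCM.D2Bridge.MuKeyIdentLemD3DelRecConjOmegaEnd (diagonal_frameD_map_complexConj)

open Summit.HodgeConjecture.CorCM.D2Bridge.MuKeyIdentLemD3DelRecConjOmegaEndT (hc_cm_of_printed_citations_muKey_ident_lemD3_delRecConjOmegaT)
open Summit.HodgeConjecture.CorCM.D2Bridge.MuKeyIdentLemD3DelRecConjOmegaEndT.PrintedCitationHypotheses (HypLiu418 Hyp411 Hyp413 HypD3 HypD1pp)  -- v4: decls of record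
open Literature.AlgebraicGeometry.Motives (AbelianVariety)
open Literature.AlgebraicGeometry.Liu2021 (IsAdmissibleElement)
open scoped DirectSum



/-! ## Registered stubs (v3: Liu's printed proof ¶1–¶3, ℓ-adic split of MAIN + (3); item (1) split (I)(D); item (2) closed) -/

/-! **v8**: the fifteen FACE-CLOSURE TYPES `StubMainGalois`, `StubLevelInvariants`, `StubNonIso`, `StubAlbTransitionEpi`, `StubHonestIsogenyDescent`, `StubBettiThetaModel`,
`StubPinBettiPinning`, `StubBettiThetaModelAtPlace`, `StubBettiThetaModelOffPlace`, `EtaleComparisonAtFace`, `StubEtaleBettiModel`, `StubFaltingsIsotypic`, `StubGaloisLabelSeparation`,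
`Thm415AtFace`, `StubMainGaloisGlue` (v3–v7 :206–:412 of this file) + the NEW name `EpsRigidAtFace` (= the type of `stub_epsRigidAtFace`) are now TREE decls of A-p18's
`CorCM/HypLiu418/A3Liu418FaceTypes.lean` (★ p608544; same namespace, bodies token-identical to v7 — A-plan2 check 06:2xZ) and are IMPORTED, exactly as v5 did with §Items. -/

/-! ## Registered stubs and slots (v4).  `sorry` lives ONLY in: the five FACT-LEVEL residuals (rows III-0, I-4, VI-1, VI-2″, III-6 — named Literature facts
without `_holds`, each stated as `theorem stub_<fact> : <the fact's Prop>` so that it is retired BY NAME the minute the fact's `_holds` lands) and the two A-side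
residuals `stub_bettiThetaModel_offPlace`, `stub_mainGaloisGlue`.  Everything else is a slot closed by a tree theorem BY NAME. -/

/-- (I) CLOSED BY NAME — A-p07's `stubAlbTransitionEpi_holds` (`HypLiu418/A3Liu418AlbTransitionEpi.lean`, p599521; row VI-3 at debt 0): every transition map of the
Albanese tower of `ℭ_V` is an epimorphism. [cite: Liu2021, Thm. 4.18 (1) proof (FJcycle.tex l. 2274–2282); Lem. 2.4 (1)] -/
theorem stub_albTransitionEpi : StubAlbTransitionEpi :=
  stubAlbTransitionEpi_holds

/-- (D) CLOSED BY NAME — A-p12's `stubHonestIsogenyDescent_holds` (`HypLiu418/A3Liu418HonestIsogenyDescent.lean` APPEND p604826; rows VI-4 ∕ VI-5 ∕ VI-6 PROVED: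
B-p16 `isogenyDescent_of_levelQuotient_holds`, `Albanese.exists_trace_of_isSepQuotient_complex`, B-typ03 `levelQuotient_printed_holds`): isogeny descent for `T_V`,
UNCONDITIONAL. [cite: Liu2021, Rem. 4.17; Prop. 4.6 (1); Lem. 2.4 (1)] -/
theorem stub_honestIsogenyDescent : StubHonestIsogenyDescent :=
  stubHonestIsogenyDescent_holds

set_option synthInstance.maxHeartbeats 400000 in
set_option maxHeartbeats 8000000 in
/-- **`stub_levelInvariants_of`** (v3, unchanged): item (1) from (I) + (D) by A-p07's composed glue `levelInvariants_transport_of_epi_of_isogenyDescent`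
(`RestOneLevelInvariantsHom.lean`, p593390) BY NAME. [cite: Liu2021, Thm 4.18 (1)] -/
theorem stub_levelInvariants_of (hI : StubAlbTransitionEpi) (hD : StubHonestIsogenyDescent) : StubLevelInvariants := by
  intro hDel F _ h6 ι₁ V a Φ hΦ ν hν hw Φ'
  exact levelInvariants_transport_of_epi_of_isogenyDescent _ _ _ _ _ _ _ _ _ _ _ _ _ _ (hI hDel F h6 V Φ) (hD hDel F h6 V Φ)

/-- (P, GAP 1) **v11: CLOSED BY NAME OUTRIGHT** — `pinBettiPinning_of_lemma24Proj` (A-p18 C2 p614256) fed with A-p17's F6 `albanese_bettiOne_pullback_bijective_of_isProjectiveOver` (p620156; [Lem 2.4 (1)] at projective smooth `X`, per-piece (R-ℂ) form = exactly C2's `hLp`); formerly (v4–v10) A-p18's `pinBettiPinning_of_lemma24` (`HypLiu418/A3Liu418PinBettiPinningAtPin.lean`, p603007, modulo row III-0, over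
`A3Liu418PinBettiPinning.lean` p602555: the pin's levels `H¹(X_K ×_{ι} ℂ; ℂ)` are identified with `H¹` of the Albanese levels by [Lem 2.4], compatibly with
restriction and Hecke translation — `Map43RecordAtPinLevels` + `ComponentAlbanesePinLaw`). [cite: Liu2021, Lem. 2.4; §4.2 l. 2074–2081] -/
theorem stub_pinBettiPinning : StubPinBettiPinning :=
  pinBettiPinning_of_lemma24Proj Literature.NumberTheory.Automorphic.Liu2021.AppendixC.albanese_bettiOne_pullback_bijective_of_isProjectiveOver   -- v11: row III-0 CLOSED BY NAME (C2 p614256 ∘ F6 p620156)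

/-- (P, AT PLACE) CLOSED BY NAME from the route's item `H413` — A-p06's junction `bettiThetaModelAtPlace_of_hyp413_of_pinning` (`HypLiu418/A3Liu418BettiThetaModelAtPlace.lean`,
p600917, over `A3Liu418BettiThetaPin.lean` p600496 ∕ `A3Liu418BettiThetaOfProp413.lean`): [Prop 4.13] AS PRINTED at the pin (`h413`) decomposes THE PIN's tower, which
`stub_pinBettiPinning` pins to the Albanese levels.  `h413 : HCCMUnconditional.H413` unfolds to the pack decl `Hyp413` (delta). [cite: Liu2021, Prop. 4.13; Thm. 4.18 proof l. 2254–2257] -/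
theorem stub_bettiThetaModelAtPlace_of (h413 : Summit.HodgeConjecture.HodgeConjecture.Theses.HCCMUnconditional.H413) (hpin : StubPinBettiPinning) :
    StubBettiThetaModelAtPlace :=
  bettiThetaModelAtPlace_of_hyp413_of_pinning h413 hpin

/-- FACT-LEVEL RESIDUAL (row I-4): [Deligne 1971, 5.5] uniqueness of canonical models for the unitary Shimura surfaces = the named fact
`UnitaryCanonicalModel.canonicalModel_unique_printed` (`UnitaryShimuraCanonicalModelUnique.lean` :147; consumer A-p02's `RecordSystem.nonempty_iso_of_canonicalModel_unique`
p604883).  It enters the cone ONLY through the off-place half of P (REF1 04:23:22Z).  Retired by the fact's `_holds` (fan B, row I-4; [Del71 3.13 ∕ 5.5], [Milne05 Thm 13.6]).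
WHY IT MIGHT FAIL: mis-typed reciprocity normalisation in the record-system axioms (sign of `rec`), cf. A3-ORIENTATION §2 — the existence row `hDel` uses the same
axioms, so an inconsistency would surface there first.  **v6: CLOSED BY NAME** `:= canonicalModel_unique_printed_holds` (A-p07 g3 p607432, row I-4 DISCHARGED).
[cite: Deligne1971TravauxShimura, 3.13, 5.5] [cite: Milne2005ShimuraVarieties, Thm. 13.6] -/
theorem stub_canonicalModel_unique_printed : Literature.AlgebraicGeometry.ShimuraVarieties.UnitaryCanonicalModel.canonicalModel_unique_printed :=
  Literature.AlgebraicGeometry.ShimuraVarieties.UnitaryCanonicalModel.canonicalModel_unique_printed_holds   -- v6: CLOSED BY NAME (A-p07 g3 p607432)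

/-- `stub_bettiThetaModel_offPlace` — A-SIDE RESIDUAL (v4; L) **CLOSED BY NAME in v6** (A-p02 D4 p607116 `stubBettiThetaModelOffPlace_of_h413_of_unique_of_lemma24`): the pinned Betti theta model at the OFF-PLACE faces (`(mk ι₁).embedding ≠ ι₁`), GIVEN
[Prop 4.13] at the pin (`H413`, route item), canonical-model uniqueness (row I-4) and [Lem 2.4] (row III-0).  OWNERS (director g2 04:36:01Z): A-p08 LEAD,
A-p02 second (casts), A-p12 Weil-carrier side (B)(i), fork default (β).  ROUTE (A-p01 OFFPLACE memo, A-p16 04:02:43Z (1)–(5), A-p08 04:21:13Z, A-p02 04:17:28Z): let `ι₀ := (mk ι₁).embedding = conj ∘ ι₁`; read `V` as a hermitian space `V₀` along `ι₀` (same `Hm`, signature swapped by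
`conjGram`); (B1∘B2) `RecordSystem.exists_conj_alongConj` turns the record of `(V, ι₁)` into a record at the conjugate datum with THE SAME complex models
(`R″.M = smallLevelConjBack ⋙ R.M ⋙ baseChangeHom conj`-shape equality); `RecordSystem.exists_of_frame` moves it to the frame `frameOf V₀`; (B3 + I-4)
`RecordSystem.nonempty_iso_of_canonicalModel_unique hU` identifies it with the END's chosen record `recordOf h V₀ h4` (model towers isomorphic over `F`,
compatibly with the uniformisations); transport `h413`'s decomposition of the pin of `V₀` (an AT-PLACE face: `(mk ι₀).embedding = ι₀`) and its pinning
(`stub_pinBettiPinning` at `V₀`, from III-0) along `Alb` of the model isomorphism (`replaceΩ`, A-p16 p604143; `H¹(Alb φ_K)` natural by `AlbaneseH1ComparisonOfLemma24`)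
back to `ℭ_V`'s Albanese levels; the labels relabel `μ ↦ μᶜ` (`muConj`), matching `UV`.  WHY PLAUSIBLY TRUE: the complex points of `Sh_K(V, ι₁)` and `Sh_K(V₀, ι₀)` are
the same ball quotients; canonical models are unique.  WHY IT MIGHT FAIL: three index casts (A-p16 04:18:03Z: `τ` propositional, `conjFrame ∘ conjFrame` vs `frameOf V₀`,
`conjLevel₀ (K3 V)` vs `K3 V₀`) — bookkeeping, each with a tree lemma (`RecordSystem.exists_eq_M_of_emb_eq ∕ _of_frame_eq`); and the relabelling `a ↦ a` must match
`repAt a` at `V₀` (same real scalar).  SIZE: L.  Antecedent types are the fact Props themselves, so the closing theorem is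
`theorem … (h413 : HCCMUnconditional.H413) (hU : canonicalModel_unique_printed) (hL : albanese_bettiOne_pullback_bijective) : StubBettiThetaModelOffPlace` (v6–v10);
**v11: the `hL` antecedent is DROPPED** — [Lem 2.4] enters by name in its projective per-piece form (A-p18 C2 `…_of_lemma24Proj` ∘ A-p17 F6), so the stub states `H413 → canonicalModel_unique_printed → StubBettiThetaModelOffPlace`.
[cite: Liu2021, Prop. 4.13; §4.2; App. C §C.1] [cite: Deligne1971TravauxShimura, 5.5] [cite: Deligne1979ShimuraVarieties, 2.2.5, Cor. 2.7.21] -/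
theorem stub_bettiThetaModel_offPlace :
    Summit.HodgeConjecture.HodgeConjecture.Theses.HCCMUnconditional.H413 →
      Literature.AlgebraicGeometry.ShimuraVarieties.UnitaryCanonicalModel.canonicalModel_unique_printed → StubBettiThetaModelOffPlace :=
  fun h413 hU => stubBettiThetaModelOffPlace_of_h413_of_unique_of_lemma24Proj Literature.NumberTheory.Automorphic.Liu2021.AppendixC.albanese_bettiOne_pullback_bijective_of_isProjectiveOver h413 hU   -- v11: RESTATED without the [Lem 2.4] arrow; CLOSED BY NAME (A-p18 C2 p614256 ∘ F6 p620156; v6–v10: A-p02 D4 p607116 `…_of_lemma24`)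

set_option synthInstance.maxHeartbeats 400000 in
set_option maxHeartbeats 8000000 in
/-- **`stub_bettiThetaModel_of`** (v4: P is a THEOREM of its two halves): case split on whether `ι₁` is the chosen embedding of its place. [cite: Liu2021, Prop. 4.13] -/
theorem stub_bettiThetaModel_of (hAt : StubBettiThetaModelAtPlace) (hOff : StubBettiThetaModelOffPlace) : StubBettiThetaModel := by
  intro hDel F _ h6 ι₁ V a Φ hΦ
  by_cases hemb : (NumberField.InfinitePlace.mk ι₁).embedding = ι₁
  · exact hAt hDel F h6 V hemb a Φ hΦ
  · exact hOff hDel F h6 V hemb a Φ hΦ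

/-- FACT-LEVEL RESIDUAL (row VI-2″): B-typ04's named fact `Sec42Data.exists_etaleHeckeDatum_with_bettiComparison` (p595473; [SGA4 XI Thm 4.4] comparison for the
Albanese tower + its Hecke ∕ Galois compatibilities) CLOSED OVER THE FACE (`EtaleComparisonAtFace`, v3 head hypothesis, now a registered fact-level stub so that the
gate-shape head carries route items only).  Retired by the fact's `_holds` (fan B; `H1ComparisonFamilyHolds.lean` is the started proof).  WHY IT MIGHT FAIL: only if
`BettiPinning`'s Hecke law and the étale datum's `IsInducedBy` disagree by an inversion `g ↦ g⁻¹` (convention check, B-typ04 02:18Z: both are pull-backs).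
**v7: CLOSED BY NAME** `:= stubEtaleComparisonAtFace_holds` (A-p16 p608142).
[cite: SGA4Tome3, Exp. XI Thm. 4.4] [cite: Liu2021, §4.2 (FJcycle.tex l. 2152–2160; print pp. 49–50)] -/
theorem stub_etaleComparisonAtFace : EtaleComparisonAtFace :=
  stubEtaleComparisonAtFace_holds   -- v7: CLOSED BY NAME (A-p16 p608142)

set_option synthInstance.maxHeartbeats 400000 in
set_option maxHeartbeats 8000000 in
/-- **`stub_etaleBettiModel_of`** (v3 proof, v4 binder `hΦ`): at `(ℓ, ι)`, take the pinned `(H, rhoB)` of `StubBettiThetaModel`, apply the comparison fact to its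
pinning, keep the induced `X`, the comparison and the decomposition. [cite: Liu2021, §4.2 (FJcycle.tex l. 2152–2160; print pp. 49–50)] -/
theorem stub_etaleBettiModel_of (hP : StubBettiThetaModel) (hEt : EtaleComparisonAtFace) : StubEtaleBettiModel := by
  intro hDel F _ h6 ι₁ V a Φ hΦ ℓ _ ι'
  obtain ⟨τ', H, _, _, rhoB, ⟨B⟩, hdec⟩ := hP hDel F h6 V a Φ hΦ
  obtain ⟨X, cmp, _, hX, -⟩ := hEt hDel F h6 V Φ ℓ τ' ι' H rhoB B
  exact ⟨X, hX, H, _, _, rhoB, ⟨cmp⟩, hdec⟩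

/-! ### §T5 → LINE T5′ (v22): ROW VI-1 CLOSED BY DERIVATION FROM `H413` — the §T5 block of v14–v21 (`HypEllPowerTower`, registered `stub_hypEllPowerTower`, R1 ∕ R2 closed by name, derived `stub_faltings_tate_bijective`) has LEFT this cone and stays on record in `Cruxes/HLiu418/Lines/faltings_isogeny.lean` v5 (A-plan1 pen; Finiteness-I comparison theorems `hypEllPowerTower_of_finitenessI` ∕ `VI1_of_finitenessI` there).  [Thm. 4.18]'s proof uses Faltings only for the face pair `(Alb X_K, A_ν)`, and for that pair it is a theorem of `H413`: see `stub_faltingsIsotypic` below. -/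

set_option synthInstance.maxHeartbeats 400000 in
set_option maxHeartbeats 8000000 in
/-- (F) CLOSED BY NAME — v22 (LINE T5′): **from the route item `H413`, with NO Faltings fact** — A-p17's `faltingsIsotypic_of_isInducedBy` (`Liu2021/AppendixC/EtaleFaltingsIsotypic.lean`;
slot text from that file's docstring: `Ψ : ℂ ⊗_{M_ν} Ω(ν) ≅_ι Hom_{Γ_E}(ℚ_ℓ^{ac}·α_ν, ℚ_ℓ^{ac} ⊗ H¹_ét(A_∞))`, `𝔾`-equivariantly, the line being a line by [Serre–Tate §4 Thm 5 (i)];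
everything but the range clause `⊇` is unconditional) applied face by face through (J2) ★ `stubFaltingsIsotypic_of_hF`, its `hF` binder (Tate-map bijectivity for the FACE pair
`(Alb X_K, A_μ(obj))`, every small level `K`, every `obj ∈ 𝒜(ν)`) supplied by F3b ★ `hF_of_h413 h413`: `H413` ⇒ multiplicity-free Hodge action on `H¹_B(Alb X_K)` ⇒ `Alb(X_K) ⊗ ℂ`
of CM type ⇒ [Fal83 §5 Kor. 1] for CM pairs as the tree theorem ★ `Theorems.hF_of_isOfCMType_alb` ([Shimura1998, Thm. 18.6]).  Through v21 this slot consumed the derived general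
statement `stub_faltings_tate_bijective` (← R2 ← R1 ← registered `stub_hypEllPowerTower`); that block has left the cone (§T5 note above).  Statement: `H413 → StubFaltingsIsotypic`
(binder added; `StubFaltingsIsotypic` text unchanged = `A3Liu418FaceTypes`). [cite: Liu2021, Thm 4.18 proof l. 2245–2263; Thm. 1.1; Cor. 4.20] [cite: Shimura1998, Thm. 18.6] -/
theorem stub_faltingsIsotypic (h413 : Summit.HodgeConjecture.HodgeConjecture.Theses.HCCMUnconditional.H413) : StubFaltingsIsotypic :=
  stubFaltingsIsotypic_of_hF (hF_of_h413 h413)   -- v22: BY NAME ((J2) A-p03 g9 ∘ F3b A-p09 g12); zero sockets besides `h413`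

/-! ## v12 — ROW III-9′ SPLIT ALONG LIU'S OWN SEAM (T2, director g3/g4 BATCH 117/120; `A-plan/LIU415-SPEC.md`):
`Thm415AtFace` ⇐ (S) [Liu 2021, Thm 4.15] PROPER in FROBENIUS FORM + (R0) «Frobenius-dense ⇒ all σ» + [Def 4.5 (2)] of the object `obj ∈ 𝒜(ν)` (in tree).

Print (FJcycle.tex l. 2177–2182, p. 50): «Suppose that `n ≥ 3` and let `(μ,ε,χ)` be an adèlic oscillator triple in which `μ` is of weight one and `ε` is
`μ`-admissible. Then `ρ_{τ',ℓ}(μ,ε,χ) ∘ τ' = μ^{alg}`.»  B-typ04's PINNED typing `Thm415Pinned` ELIMINATES `μ^{alg}` against Def 4.5 (2) (l. 2263: `Γ` acts on the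
`M_μ`-eigenline `ℚ_ℓ^{ac}·α` of `H¹_ét(A_μ)` by `ι_ℓ∘μ^{alg}∘(τ')⁻¹`), so a kernel proof of the v11 stub needs print's Thm 4.15 AND the CM leg, joined at `μ^{alg}`.
READ AT ARITHMETIC FROBENII the join needs no Artin map: (S) `Thm415Frobenius` — for all `v` outside a finite set, every arithmetic Frobenius at `𝔓 ∣ v` acts on
`Hom_{ℚ_ℓ^{ac}[𝔾]}(ι∘ω(μ,ε,χ), ℚ_ℓ^{ac} ⊗ H¹_ét(A_∞))` by `ι(μ^{alg}(ϖ_v))⁻¹` (text = A-p12 g4's `hfrob` binder of `thm415Pinned_of_frobenius`, report-first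
1ace9bfdb503f604, VERBATIM); (R0) `R0FrobeniusToPinned` — (S) + Def 4.5 (2) in Frobenius form (`Def45.IsCMCharacterMuAlg`, whose eigenline consequence is A-p18's ★
`galoisH1Bar_eq_smul_of_isCMCharacterMuAlg`, scalar `ι(μ^{alg}(ϖ_v))⁻¹` on `cmEigenline`) ⇒ `Thm415Pinned`, by closedness of the common-eigenvector locus
(`continuous_rationalTateRep_holds`), its stability under products, cofiniteness of good places (★ `exists_finite_forall_exists_isAbelianSchemeModel`, conductor of
`μ^{alg}`, `ℓ ∤ v`) and the tree's unconditional density criterion ★ `absoluteGaloisGroup.eq_univ_of_frobenius_mem_of_hasDirichletDensity_one` — PROVED in A-p12's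
folder file (THEOREMS ONLY, 0 sorry), to land as `Liu2021/AppendixC/Thm415PinnedOfFrobenius.lean`; this item is CLOSED BY NAME here (`stub_R0_frobeniusToPinned := … thm415Pinned_of_frobenius …`).  The face composition `thm415AtFace_of_R0_S` below is kernel-checked; `stub_thm415AtFace` becomes a DERIVED theorem (name and
statement kept, so (S)-consumer `stub_galoisLabelSeparation` and the head are byte-identical).  (S) stays FACT-LEVEL (XXL): its printed proof = theta realisation
(S1) · «theta restricts to theta» along `U(V⋆) × U(V⋆^⊥) ↪ U(V)` (S2, l. 2199–2210; Literature-side theorems in flight `--supports` this item) · [MR92 Prop 6]-type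
detection by special CURVES (S3, fn. 9; tree ★ III-8 `MR92Prop6`) · the curve case App. D Thm D.6 (1) in the `(1,0)` branch of Rem D.5 = μ-admissibility (S4; Prop D.8
congruence relation after [Car86], Cor D.9, [Raj00 Thm 1], CM factor of the Jacobian) · Galois-equivariant restriction along the E-morphism of towers (S5, needs the
rank-2 canonical-model receptacle shared with T3) — A-p09 g4 READFIRST 4d7c9bdbe8d47e4d §2–§4, A-p12 g4 e82ca0b0b8b80975; its split into registered stubs waits for
the rank-2 receptacle (SPEC §7).  REGISTERED `sorry`s: 2 → 2 = {`stub_faltings_tate_bijective` (VI-1), `stub_S_thm415Frobenius` (III-9′(S))} (III-9′(R0) `stub_R0_frobeniusToPinned` closed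
by name); every v11 `theorem` statement token-identical; imports unchanged; zero mathematical content asserted beyond the two new named statements.
HC_CM is proved only modulo the 7 printed citations until rung 0 closes. -/

section T2

open IsDedekindDomain
open scoped NumberField
open Literature.NumberTheory.GaloisRepresentations
open Literature.AlgebraicGeometry.Motives (AbelianVariety)
open Literature.AlgebraicGeometry.Liu2021 (IsAdmissibleElement)

/-- S5 (generic, THEOREM-GRADE — k19 `OmegaHomPullback` closes it): per-`f` Frobenius-scalar TRANSFER along an étale tower morphism under
«`f` spans the Hom-space» and «the pull-back of `f` is non-zero», the source-side scalar statement being quantified over the whole source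
Hom-space (S4 shape). [cite: Liu2021, Thm. 4.15 proof (FJcycle.tex l. 2199–2213)] -/
def S5Transfer : Prop :=
  ∀ {F E : Type} [Field F] [NumberField F] [IsTotallyReal F] [Field E] [NumberField E] [Algebra F E]
    [IsTotallyComplex E] [Algebra.IsQuadraticExtension F E] {P5ₛ P5 : PropC5Data F E} {isoₛ iso : ℕ → Prop}
    (Cₛ : Sec42Data P5ₛ isoₛ) (C : Sec42Data P5 iso) (Tₛ : Cₛ.HeckeTranslates) (T : C.HeckeTranslates)
    (φ : Cₛ.G →* C.G) (hφ : Continuous φ) (_hK₀ : (Cₛ.S.K₀.1 : Subgroup Cₛ.G).map φ ≤ C.S.K₀.1)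
    (M : Sec42Data.EtaleTowerHom Cₛ C Tₛ T φ hφ) (ℓ : ℕ) [Fact ℓ.Prime]
    (X : C.EtaleHeckeDatum ℓ) (Xₛ : Cₛ.EtaleHeckeDatum ℓ), X.IsInducedBy T → Xₛ.IsInducedBy Tₛ →
    ∀ (ι : ℂ ≃+* AlgebraicClosure ℚ_[ℓ]) {W : Type} [AddCommGroup W] [Module ℂ W] (ρW : Representation ℂ C.G W)
      (σ : Field.absoluteGaloisGroup E) (c : AlgebraicClosure ℚ_[ℓ])
      (f : W →ₛₗ[(ι : ℂ →+* AlgebraicClosure ℚ_[ℓ])] AlgebraicClosure ℚ_[ℓ] ⊗[ℚ_[ℓ]] C.etaleH1Tower ℓ),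
      f ∈ X.omegaHom ι ρW →
      (∀ g ∈ X.omegaHom ι ρW, ∃ b : AlgebraicClosure ℚ_[ℓ], g = b • f) →
      ((M.etPull ℓ).baseChange (AlgebraicClosure ℚ_[ℓ])).comp f ≠ 0 →
      (∀ f' ∈ Xₛ.omegaHom ι (ρW.comp φ), ∀ w : W,
          (Cₛ.towerRep ℓ σ).baseChange (AlgebraicClosure ℚ_[ℓ]) (f' w) = c • f' w) →
      ∀ w : W, (C.towerRep ℓ σ).baseChange (AlgebraicClosure ℚ_[ℓ]) (f w) = c • f w

section T2General

variable {F E : Type} [Field F] [NumberField F] [IsTotallyReal F] [Field E] [NumberField E] [Algebra F E]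
  [IsTotallyComplex E] [Algebra.IsQuadraticExtension F E]
variable {P5 : PropC5Data F E} {isotropicAt : ℕ → Prop}

/-- **III-9′(S) — [Liu 2021, Thm 4.15] PROPER, FROBENIUS FORM** (print l. 2177–2182 «`ρ_{τ',ℓ}(μ,ε,χ) ∘ τ' = μ^{alg}`» read at arithmetic Frobenii; text = the `hfrob`
binder of A-p12 g4's `thm415Pinned_of_frobenius`, verbatim): for `n ≥ 3`, `μ` of weight one, `ε` `μ`-admissible and every `χ`, there is a finite set `S` of finite places
of `E` such that for every `v ∉ S`, every prime `𝔓 ∣ v` of `ℤ̄_E` and every ARITHMETIC Frobenius `σ` at `𝔓`, `σ` acts on every value `f w` of every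
`f ∈ Hom_{ℚ_ℓ^{ac}[𝔾]}(ι∘ω(μ,ε,χ), ℚ_ℓ^{ac} ⊗ H¹_ét(A_∞))` (`X.omegaHom ι (U.rho μ hμ ε χ)`) by the scalar `ι(μ^{alg}(ϖ_v))⁻¹` (arithmetic Frobenius on an `H¹`:
the inverse of the uniformiser value, as on `cmEigenline` in `galoisH1Bar_eq_smul_of_isCMCharacterMuAlg`).  No `A_μ`, no `i_μ`: closer to print than the pinned form
and free of its free-binder hazard.  FACT-LEVEL; printed proof = S1–S5 of the section docstring. DEFINED; nothing asserted.
[cite: Liu2021, Thm. 4.15 (FJcycle.tex l. 2177–2182); §4.2 (FJcycle.tex l. 2162–2174; print pp. 49–50); proof l. 2185–2213 with fn. 9; App. D Rem. D.5, Thm. D.6 (1), Prop. D.8, Cor. D.9]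
[cite: MurtyRamakrishnan1992, Prop. 6] [cite: Carayol1986, §§6–10] [cite: Rajan2000, Thm. 1] -/
def Thm415Frobenius (C : Sec42Data P5 isotropicAt) (U : UniformOmega C) (ℓ : ℕ) [Fact ℓ.Prime] (X : C.EtaleHeckeDatum ℓ)
    (ι : ℂ ≃+* AlgebraicClosure ℚ_[ℓ]) (μ : Literature.NumberTheory.Automorphic.IdeleClassGroup E →ₜ* Circle)
    (hμ : letI : IsCMField E := isCMField F E; IdeleClassGroup.IsConjugateSymplectic E μ) : Prop :=
  letI : IsCMField E := isCMField F E
  3 ≤ C.n → IdeleClassGroup.HasWeight E μ 1 →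
    ∀ (ε : U.Eps), (∃ e : E, IsAdmissibleElement E hμ.cmType.1 e ∧ U.epsOf e = ε) → ∀ (χ : U.Chi),
      ∃ S : Set (HeightOneSpectrum (𝓞 E)), S.Finite ∧
        ∀ v ∉ S, ∀ 𝔓 ∈ v.primesAbove, ∀ σ : Field.absoluteGaloisGroup E, IsArithFrobAt (𝓞 E) σ 𝔓 →
          ∀ f ∈ X.omegaHom ι (U.rho μ hμ ε χ), ∀ w : U.omega μ hμ ε χ,
            (C.towerRep ℓ σ).baseChange (AlgebraicClosure ℚ_[ℓ]) (f w) =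
              (ι ((IdeleClassGroup.muAlg E μ).valueAtUniformizer v))⁻¹ • f w


/-! ### v16 — THE (S)-SPLIT, GENERIC LAYER: carriers `SeesawSource` ∕ `Mult1OmegaHom` ∕ `SeesawSource.FrobeniusActsBy` ∕ `S34SomeSource` are ★
`Literature/NumberTheory/Automorphic/Liu2021/AppendixC/SeesawSource.lean` (B-typ02 g7; statements token-identical to v15's local layer, now deleted); the glue stays here. -/

set_option maxHeartbeats 2000000 in
/-- **GLUE (generic, proved): MULT1 + S34 + S5 ⇒ [Thm 4.15] in Frobenius form.**  Fix `(ε, χ)`.  If the Hom-space is zero there is nothing to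
prove (`S := ∅`).  Else pick `f₀ ≠ 0`; S34 gives a pinned source `s` with `pull f₀ ≠ 0` and its finite set `S`; for `v ∉ S` and a
Frobenius `σ`, S5 transfers the scalar to `f₀` (MULT1 = «`f₀` spans»), and every `f = b • f₀` follows by linearity.
[cite: Liu2021, Thm. 4.15 proof (FJcycle.tex l. 2185–2213)] -/
theorem thm415Frobenius_of_split (C : Sec42Data P5 isotropicAt) (U : UniformOmega C) (ℓ : ℕ) [Fact ℓ.Prime]
    (X : C.EtaleHeckeDatum ℓ) (ι : ℂ ≃+* AlgebraicClosure ℚ_[ℓ])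
    (μ : Literature.NumberTheory.Automorphic.IdeleClassGroup E →ₜ* Circle)
    (hμ : letI : IsCMField E := isCMField F E; IdeleClassGroup.IsConjugateSymplectic E μ) (T : C.HeckeTranslates)
    (Pin : ∀ {P5ₛ : PropC5Data F E} {isoₛ : ℕ → Prop} (Cₛ : Sec42Data P5ₛ isoₛ), (Cₛ.G →* C.G) → Prop)
    (hX : X.IsInducedBy T) (h1 : Mult1OmegaHom C U ℓ X ι μ hμ) (h34 : S34SomeSource C U ℓ X ι μ hμ T Pin)
    (h5 : S5Transfer) : Thm415Frobenius C U ℓ X ι μ hμ := by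
  intro hn hw ε hε χ
  classical
  by_cases h0 : ∀ f ∈ X.omegaHom ι (U.rho μ hμ ε χ), f = 0
  · refine ⟨∅, Set.finite_empty, ?_⟩
    intro v _ 𝔓 _ σ _ f hf w
    rw [h0 f hf]
    simp
  · push Not at h0
    obtain ⟨f₀, hf₀, hne⟩ := h0
    obtain ⟨s, hs, S, hSfin, hS⟩ := h34 hn hw ε hε χ f₀ hf₀ hne
    refine ⟨S, hSfin, ?_⟩
    intro v hv 𝔓 h𝔓 σ hσ f hf w
    obtain ⟨b, rfl⟩ := h1 hn hw ε hε χ f₀ hf₀ f hf hne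
    have key := h5 s.Cₛ C s.Tₛ T s.φ s.hφ s.hK₀ s.M.toEtaleTowerHom ℓ X s.Xₛ hX s.hXₛ ι (U.rho μ hμ ε χ) σ
      ((ι ((IdeleClassGroup.muAlg E μ).valueAtUniformizer v))⁻¹) f₀ hf₀
      (fun g hg => h1 hn hw ε hε χ f₀ hf₀ g hg hne) hs (hS v hv 𝔓 h𝔓 σ hσ) w
    rw [LinearMap.smul_apply, map_smul, key, smul_comm]

end T2General

/-- **III-9′(R0) — «FROBENIUS-DENSE ⇒ ALL σ»** (the pinned form from the Frobenius form and [Liu 2021, Def. 4.5 (2)] in Frobenius form for `(A_μ, i_μ)`), stated for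
EVERY Appendix-C datum exactly as A-p12 g4's `thm415Pinned_of_frobenius` (report-first 1ace9bfdb503f604, THEOREMS ONLY, 0 sorry): fix `x ≠ 0` on the eigenline and
`y = f w`; `Z = {σ | ∃ a, σx = a·x ∧ σy = a·y}` is closed (both actions are base changes of CONTINUOUS rational Tate representations, `y` sits at one level of the tower;
`isClosed_setOf_exists_common_smul`), stable under products, and contains every arithmetic Frobenius over the cofinite set of places with an abelian-scheme model of
`A_μ` (★ `exists_finite_forall_exists_isAbelianSchemeModel`), unramified for `μ^{alg}`, prime to `ℓ` and outside `S` (★ `galoisH1Bar_eq_smul_of_isCMCharacterMuAlg` +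
(S)); the tree's unconditional density criterion ★ `absoluteGaloisGroup.eq_univ_of_frobenius_mem_of_hasDirichletDensity_one` gives `Z = Γ_E`; compare scalars on `x ≠ 0`.
PROVABLE NOW (size M; the FIRST RUNG of T2); closed BY NAME when that file lands. DEFINED; nothing asserted.
[cite: Liu2021, Thm. 4.15 with §4.2 (FJcycle.tex l. 2162–2174; print pp. 49–50), Def. 4.5 (2) (l. 1952), Thm. 4.18 proof (l. 2263)] [cite: SerreTate1968, §1 and §7 Thm. 10–11]
[cite: NeukirchANT1999, Ch. VII §13] -/
def R0FrobeniusToPinned : Prop :=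
  ∀ {F E : Type} [Field F] [NumberField F] [IsTotallyReal F] [Field E] [NumberField E] [Algebra F E]
    [IsTotallyComplex E] [Algebra.IsQuadraticExtension F E] {P5 : PropC5Data F E} {isotropicAt : ℕ → Prop}
    (C : Sec42Data P5 isotropicAt) (U : UniformOmega C) (ℓ : ℕ) [Fact ℓ.Prime] (X : C.EtaleHeckeDatum ℓ)
    (ι : ℂ ≃+* AlgebraicClosure ℚ_[ℓ]) (μ : Literature.NumberTheory.Automorphic.IdeleClassGroup E →ₜ* Circle)
    (hμ : letI : IsCMField E := isCMField F E; IdeleClassGroup.IsConjugateSymplectic E μ)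
    (Aμ : AbelianVariety E) (iμ : IdeleClassGroup.muAlgValueField E μ →+* Aμ.endAlgebra),
    Def45.IsCMCharacterMuAlg μ Aμ iμ → Thm415Frobenius C U ℓ X ι μ hμ → Thm415Pinned C U ℓ X ι μ hμ Aμ iμ

set_option synthInstance.maxHeartbeats 400000 in
set_option maxHeartbeats 8000000 in
/-- **III-9′(S) AT THE FACE**: [Thm 4.15] proper in Frobenius form for `V`'s own datum `ℭ_V`, the family `muConj 𝕌_V` at `a`, every INDUCED étale Hecke datum `X`, every
`ι`, at every conjugate-symplectic weight-one label `ν` — the binders of `Thm415AtFace` WITHOUT `obj` (no `A_ν`, `i_ν`).  The orientation question S1 (A3-ORIENTATION §3;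
Rem D.5's `(1,0)` branch) lives HERE exactly as it did in `Thm415AtFace`. [cite: Liu2021, Thm. 4.15 (l. 2177–2182), proof l. 2185–2213, App. D Thm. D.6 (1)]
[cite: MurtyRamakrishnan1992, Prop. 6] -/
def Thm415FrobeniusAtFace : Prop :=
  ∀ (hDel : Literature.AlgebraicGeometry.ShimuraVarieties.UnitaryCanonicalModel.canonicalModel_exists_printed)
      (F : HodgeCM.CMField) [IsGalois ℚ F] (h6 : 6 ≤ Module.finrank ℚ F) {ι₁ : F →+* ℂ} (V : HodgeCM.HermSpace3 F ι₁) (a : RealScalar F)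
      (Φ : CMType F) (_hΦ : ι₁ ∈ Φ.1) (ν : Literature.NumberTheory.Automorphic.IdeleClassGroup (F : Type) →ₜ* Circle)
      (hν : IdeleClassGroup.IsConjugateSymplectic (F : Type) ν) (_hw : IdeleClassGroup.HasWeight (F : Type) ν 1)
      (ℓ : ℕ) [Fact ℓ.Prime] (X : (CV hDel F V Φ).EtaleHeckeDatum ℓ) (ι' : ℂ ≃+* AlgebraicClosure ℚ_[ℓ]),
      X.IsInducedBy (TV hDel F h6 V Φ) →
        Thm415Frobenius (CV hDel F V Φ) (UV hDel F V a Φ) ℓ X ι' ν hν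


/-! ### v15 — THE (S)-SPLIT AT THE FACE: the junk-excluding PIN (census k20; v16: PIN P′, source group `U(V⋆)` alone) and the AtFace statements MULT1 ∕ S34 -/

section Face

open Literature.NumberTheory.Automorphic.UnitaryGroup

/-- **The face PIN DATA of a seesaw source** (junk-excluding, B-p19 receptacle pattern; census k20; **v16: PIN P′ — the source group is
`U(V⋆)` ALONE, Liu-literal**: l. 2193 «the Shimura variety `Sh(G⋆,h⋆)` together with the morphism `Sh(G⋆,h⋆) → Sh(G,h)` over `E`», l. 2203–2208
(`g⋆` acts on the `V⋆`-variable only), App. D's `G = Res U(V⋆)`; A-plan2 g5 GS finding F6, director g6 s82): a `2 + 1` Gram splitting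
`ᵗ(c B)·H_V·B = J⋆ ⊕ J⊥` of `V`'s hermitian form in an adapted `F`-frame `B` with `J⊥` TOTALLY POSITIVE (so `W = F·B e₃` is a totally positive
line and `V⋆ = W^⊥` has Gram `J⋆`), an identification `eG` of the source group with `U(J⋆)(𝔸_{F⁺,f})`, and the equation
`φ ∘ eG⁻¹ = R_B ∘ blockdiag(·, 1)` pinning `φ` to the inclusion `U(V⋆) ↪ U(V⋆) × U(V⋆^⊥) ↪ U(V)`, `u ↦ R_B (u ⊕ 1)` (finite-adelic points;
`(ℭ_V).G = U(H_V)(𝔸_{F⁺,f})` by `rfl`, `Model.honestP5Of_G`).  (v15's pin P identified the source group with the PRODUCT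
`U(J⋆)(𝔸_f) × U(J⊥)(𝔸_f)` — our generalisation of print, sound but dearer: GS-PROGRAMME memo F6.)
[cite: Liu2021, Thm. 4.15 proof l. 2193, l. 2199–2210; App. D l. 4579] [cite: Kudla1984, §1] [cite: PlatonovRapinchuk1994, §2.3] -/
structure FacePinData (F : HodgeCM.CMField) {ι₁ : F →+* ℂ} (V : HodgeCM.HermSpace3 F ι₁)
    (Gₛ : Type) [Group Gₛ] [TopologicalSpace Gₛ]
    (φ : Gₛ →* ↥(finAdelic ↥(maximalRealSubfield (F : Type)) (F : Type) (IsCMField.complexConj (F : Type)) 3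
      (HodgeCM.HermSpace3.Hm V))) where
  Jstar : Matrix (Fin 2) (Fin 2) (F : Type)
  Jperp : Matrix (Fin 1) (Fin 1) (F : Type)
  B : GL (Fin 3) (F : Type)
  hB : Literature.NumberTheory.Automorphic.formCongr ((IsCMField.complexConj (F : Type) : (F : Type) ≃ₐ[↥(maximalRealSubfield (F : Type))] (F : Type)) : (F : Type) →+* (F : Type)) B
      ((1 : (F : Type)) • HodgeCM.HermSpace3.Hm V) = finSum 2 1 Jstar Jperp
  hpos : ∀ τ : (F : Type) →+* ℂ, 0 < (τ (Jperp 0 0)).re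
  eG : Gₛ ≃ₜ* ↥(finAdelic ↥(maximalRealSubfield (F : Type)) (F : Type) (IsCMField.complexConj (F : Type)) 2 Jstar)
  φ_pin : ∀ u, φ (eG.symm u) =
    finAdelicCongr ↥(maximalRealSubfield (F : Type)) (F : Type) (IsCMField.complexConj (F : Type)) B one_ne_zero hB
      (finAdelicBlockDiag ↥(maximalRealSubfield (F : Type)) (F : Type) (IsCMField.complexConj (F : Type)) 2 1 Jstar Jperp (u, 1))

set_option synthInstance.maxHeartbeats 400000 in
set_option maxHeartbeats 8000000 in
/-- The face pin as the `Pin` parameter of `SeesawSource` for `V`'s own datum `ℭ_V`. -/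
def FacePin (hDel : Literature.AlgebraicGeometry.ShimuraVarieties.UnitaryCanonicalModel.canonicalModel_exists_printed)
    (F : HodgeCM.CMField) [IsGalois ℚ F] {ι₁ : F →+* ℂ} (V : HodgeCM.HermSpace3 F ι₁) (Φ : CMType F)
    {P5ₛ : PropC5Data ↥(maximalRealSubfield (F : Type)) (F : Type)} {isoₛ : ℕ → Prop} (Cₛ : Sec42Data P5ₛ isoₛ)
    (φ : Cₛ.G →* (CV hDel F V Φ).G) : Prop :=
  Nonempty (FacePinData F V Cₛ.G φ)

set_option synthInstance.maxHeartbeats 400000 in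
set_option maxHeartbeats 8000000 in
/-- **MULT1 AT THE FACE** (line form). NOT a floor row: closing plan = bridge from III-J3a ★ `multiplicity_le_one_printed` (director g4 s71 (1)). -/
def Mult1AtFace : Prop :=
  ∀ (hDel : Literature.AlgebraicGeometry.ShimuraVarieties.UnitaryCanonicalModel.canonicalModel_exists_printed)
      (F : HodgeCM.CMField) [IsGalois ℚ F] (h6 : 6 ≤ Module.finrank ℚ F) {ι₁ : F →+* ℂ} (V : HodgeCM.HermSpace3 F ι₁) (a : RealScalar F)
      (Φ : CMType F) (_hΦ : ι₁ ∈ Φ.1) (ν : Literature.NumberTheory.Automorphic.IdeleClassGroup (F : Type) →ₜ* Circle)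
      (hν : IdeleClassGroup.IsConjugateSymplectic (F : Type) ν) (_hw : IdeleClassGroup.HasWeight (F : Type) ν 1)
      (ℓ : ℕ) [Fact ℓ.Prime] (X : (CV hDel F V Φ).EtaleHeckeDatum ℓ) (ι' : ℂ ≃+* AlgebraicClosure ℚ_[ℓ]),
      X.IsInducedBy (TV hDel F h6 V Φ) →
        Mult1OmegaHom (CV hDel F V Φ) (UV hDel F V a Φ) ℓ X ι' ν hν

set_option synthInstance.maxHeartbeats 400000 in
set_option maxHeartbeats 8000000 in
/-- **S34 AT THE FACE** (FACT-LEVEL, XXL; fan-B rows #62∕#63 reserved, director s74): the seesaw input of [Thm 4.15]'s proof for `V`'s own datum `(ℭ_V, T_V)`, the family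
`muConj 𝕌_V` at `a`, every induced étale Hecke datum, every `ι'`, at every conjugate-symplectic weight-one `ν` — existential over PINNED sources (`FacePin`).
> PRINT: the source in print is the canonical curve tower of `U(V⋆)`, `V⋆ = W^⊥` for a totally positive line `W`; the `∃` is witnessed by it and by nothing junk.
[cite: Liu2021, Thm. 4.15 proof p. 51 l. 2199–2213 with fn. 9; App. D Rem. D.5, Thm. D.6 (1), Prop. D.8, Cor. D.9] [cite: MurtyRamakrishnan1992, Prop. 6 and Lemma B]
[cite: Milne2005ShimuraVarieties, Thm. 13.6 p. 118] [cite: Carayol1986, §10.3] [cite: Rajan2000, Thm. 1] -/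
def S34AtFace : Prop :=
  ∀ (hDel : Literature.AlgebraicGeometry.ShimuraVarieties.UnitaryCanonicalModel.canonicalModel_exists_printed)
      (F : HodgeCM.CMField) [IsGalois ℚ F] (h6 : 6 ≤ Module.finrank ℚ F) {ι₁ : F →+* ℂ} (V : HodgeCM.HermSpace3 F ι₁) (a : RealScalar F)
      (Φ : CMType F) (_hΦ : ι₁ ∈ Φ.1) (ν : Literature.NumberTheory.Automorphic.IdeleClassGroup (F : Type) →ₜ* Circle)
      (hν : IdeleClassGroup.IsConjugateSymplectic (F : Type) ν) (_hw : IdeleClassGroup.HasWeight (F : Type) ν 1)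
      (ℓ : ℕ) [Fact ℓ.Prime] (X : (CV hDel F V Φ).EtaleHeckeDatum ℓ) (ι' : ℂ ≃+* AlgebraicClosure ℚ_[ℓ]),
      X.IsInducedBy (TV hDel F h6 V Φ) →
        S34SomeSource (CV hDel F V Φ) (UV hDel F V a Φ) ℓ X ι' ν hν (TV hDel F h6 V Φ) (FacePin hDel F V Φ)

set_option synthInstance.maxHeartbeats 400000 in
set_option maxHeartbeats 8000000 in
/-- **GLUE AT THE FACE (proved): MULT1 + S34 + S5 ⇒ III-9′(S) `Thm415FrobeniusAtFace`.** -/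
theorem thm415FrobeniusAtFace_of_split (h1 : Mult1AtFace) (h34 : S34AtFace) (h5 : S5Transfer) :
    Thm415FrobeniusAtFace := by
  intro hDel F _ h6 ι₁ V a Φ hΦ ν hν hw ℓ _ X ι' hX
  exact thm415Frobenius_of_split (CV hDel F V Φ) (UV hDel F V a Φ) ℓ X ι' ν hν (TV hDel F h6 V Φ) (FacePin hDel F V Φ) hX
    (h1 hDel F h6 V a Φ hΦ ν hν hw ℓ X ι' hX) (h34 hDel F h6 V a Φ hΦ ν hν hw ℓ X ι' hX) h5

end Face

/-- MULT1 CLOSED BY NAME (v17) — [Liu 2021, Prop. 4.13] multiplicity one of `ω(μ,ε,χ)` in `H¹_ét` at the face, line form, from the route item `H413`: A-p09 g5 k21 ★ p650508 `Summits/HodgeConjecture/HodgeConjecture/Theorems/A3Liu418Mult1AtFace.lean :: mult1AtFace_of_h413` (Betti [Prop 4.13] ∕ `H413` → the étale line form through the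
Betti–étale comparison ★ VI-2″ and B-p14 ★ p645003 `sep_weightOne_at`; KcPaste fallback edition per director g6 s81 (2), re-pointed to the import when that olean serves).
Registered text (v15d, director s77 (2) ∕ s79 (2)) unchanged; the slot is filled, so the registered `sorry`s read {`stub_hypEllPowerTower` (VI-1), `stub_S34` (GS residual)}.
[cite: Liu2021, Prop. 4.13 (FJcycle.tex l. 2113–2119); Thm. 4.15 proof l. 2185] -/
theorem stub_MULT1 : Summit.HodgeConjecture.HodgeConjecture.Theses.HCCMUnconditional.H413 → Mult1AtFace :=
  fun h413 => mult1AtFace_of_h413 h413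

/-- III-8′ CLOSED BY NAME (v19) — the v18 registered fact-level slot (row III-8 RE-POINTED to the SOURCE form ★ p648408; [MR92, Prop. 6 ∕ Lemma A ∕ Lemma B] as
invoked in [Liu 2021] proof of Thm. 4.15 l. 2212 + fn. 9): every non-zero class in `H¹(X(ℂ); ℂ)` of a compact arithmetic 2-ball quotient is detected on a
compatible special curve of a totally positive line — datum-universal prefix, exactly the F6 binder `hMR` — is PROVED in the tree by A-p05's ★ p694505
`UnitaryBallUniformisationDatum.mr92Prop6Source` (statement text of this slot UNCHANGED; body = the by-name reference).
[cite: MurtyRamakrishnan1992, §5 Prop. 6 p. 460; Lemma A p. 461; Lemma B p. 462; Cor. C p. 463] [cite: Liu2021, proof of Thm. 4.15, l. 2212 and footnote 9] [cite: VoisinHodgeI2002, §6.1.3 Cor. 6.12; §7.3.2; Lemma 7.28] -/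
theorem stub_MR92Prop6Source : ∀ {X : Literature.AlgebraicGeometry.Motives.SchemeOver ℂ}
    (D : Literature.AlgebraicGeometry.ShimuraVarieties.UnitaryBallUniformisationDatum 2 X), D.MR92Prop6Source :=
  fun D => D.mr92Prop6Source

/-- **REGISTERED STUB (v21, v2y) — `stub_D6 : thmD6OneCurveCUF`** = [Liu2021, Thm. D.6 (1)] for the unitary Shimura CURVE `Sh(U(J⋆))` ALONE,
FACT-LEVEL, in GS-6's (`muConj`) currency (NAMED FACT ★ S-4α `A3Liu418GSThmD6OneCurve.thmD6OneCurveCUF`, D-0014; declseg sha16 e57225827176fb89;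
see that decl's docstring for the print, the dictionary `ν ↦ νᶜ`, the uniformity of the exceptional set and the junk analysis; ≤-print audit of record REF1 (g9) m02 2026-08-29T12:22:49Z + repair C′: the normaliser is PINNED to `(2 * imagUnit (K F))⁻¹` — the instance of print's see-saw piece, [Liu2021, l. 2199–2212] — no free `δ'` binder, so no junk slice of `epsOf` and no odd `locF`-twist of the Rem. D.5 branch enters the statement).  REPLACES the v18–v20
registered fact-level slot `stub_GS6 : frobeniusActsByGS` (GS-6 = [Liu2021, proof of Thm. 4.15 l. 2199–2212]: Frobenii act on the
`ω(ν,ε,χ)|_{U(J⋆)}`-Hom-space of `ℚ̄_ℓ ⊗ H¹_ét` of the GS curve tower by `(ι′ ν^{alg}(ϖ_v))⁻¹`), which is now DERIVED below (`gs6_of_D6`) from this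
one-curve statement by the (β) decomposition road ★ `frobeniusActsByGS_of_thmD6` (decompose `ω(ν,ε,χ)|_{U(V⋆)} = ⊕_i ω⋆(ν,ε_i,χ_i) ⊗ M_i` along
`V = V⋆ ⊕ V⋆^⊥` at the adapted frame, [Liu2021, l. 2193–2212 + Rem. D.5], transport to the face model, apply D.6 (1) per label; degenerate-sign
branch excluded by Sylvester).  Print depth of the registered residual drops from «Thm. 4.15 proof + App. D for the tower» to «Thm. D.6 (1) for one
curve» (proof = [Liu2021, §D.4 pp. 139–140: Prop. D.8, Cor. D.9], Rogawski's endoscopic classification for `U(2) × U(1)`).  NOT OFFERED TO PROVERS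
as a target of this line (fan-B capital row III-14′; a proof formalises [Liu2021, App. D §D.4]).
WHY IT MIGHT FAIL: only by a currency mismatch between `thmD6OneCurveCUF`'s arithmetic-Frobenius ∕ inverse-uniformiser normalisation and print's
`ρ_ℓ(π^∞) = μ·|·|_E^{−1/2}` (checked at typing: same normalisation as `S34SomeSource` ∕ GS-6 ∕ `cmEigenline`), or on the anisotropic label ambiguity
for `n = 2` (Lemma D.1 (4): the eigenvalue is the label's own `μ` either way — no `τ′₁ ∈ Φ_μ` binder carried).
[cite: Liu2021, Thm. D.6 (1) p. 132 (l. 5433–5443); Prop. D.4 (1) p. 130; Rem. D.5 p. 131 (l. 5396–5405); §D.3 l. 5353–5359; §D.4 proof pp. 139–140 (Prop. D.8 p. 135, Cor. D.9 p. 138); Thm. 4.15 proof p. 51 (l. 2199–2212)] [cite: Rogawski1990, §13.3] [cite: Carayol1986Compositio, §10.3 p. 210] [cite: Rajan2000, Thm. 1] -/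
theorem stub_D6 : thmD6OneCurveCUF := by
  sorry

/-- **GS-6 DERIVED (v21, v2y)** — the v18–v20 registered slot `frobeniusActsByGS` ([Liu2021, proof of Thm. 4.15 l. 2199–2212 + App. D Rem. D.5 + Thm. D.6 (1)],
NAMED FACT ★ p689530) is no longer a `sorry` of this line: it follows from the one-curve fact `stub_D6` by the kernel-checked (β) road
★ `A3Liu418GSFrobeniusOfThmD6.frobeniusActsByGS_of_thmD6` (zero sockets; wave-2 files of the GS-6 (β) programme, cell hodgecm-mathlib 2026-08-29).
Statement text of `frobeniusActsByGS` UNCHANGED; consumers (`stub_S34`) now take this theorem where they took `stub_GS6`.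
[cite: Liu2021, Thm. 4.15 proof p. 51 (l. 2193–2212); App. D Rem. D.5 p. 131, Thm. D.6 (1) p. 132] -/
theorem gs6_of_D6 : frobeniusActsByGS :=
  frobeniusActsByGS_of_thmD6 stub_D6

/-- S34 CLOSED BY NAME (v18; v20: GS-3 DISCHARGED) — the seesaw input of [Liu 2021, Thm. 4.15]'s proof at the face (`S34AtFace`, v15 registered text UNCHANGED) from the
two registered fact-level stubs III-8′ (proved v19) ∕ GS-6 by A-p09's GS-8 edition-2 head `s34SomeSource_CV_of_GS'` (over ★ `Theorems/A3Liu418S34ClauseOneOfCurveRecords` primed clause (1)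
`exists_seesawSourceGS_etPull_comp_ne_zero'` ← GS-3″ ★ `exists_recordSystemGS_of_recordSystem`, (b) ★ p683305 `seesawSourceGS`, GS-4 ★ p681495, F3 ★ p680277, F4 ★ p681047, F5 ★ p681049, 7-src ★ p672440/p673944):
the face PIN is packed from the closer's `mkPin` callback (D-ii′) with ZERO unification at the registry.
[cite: Liu2021, Thm. 4.15 proof p. 51 l. 2199–2213 with fn. 9; App. D Rem. D.5, Thm. D.6 (1)] [cite: MurtyRamakrishnan1992, Prop. 6] [cite: Milne2005ShimuraVarieties, Thm. 13.6 p. 118] -/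
theorem stub_S34 : S34AtFace := by
  intro hDel F _ h6 ι₁ V a Φ hΦ ν hν hw ℓ _ X ι' hX
  exact s34SomeSource_CV_of_GS' stub_MR92Prop6Source gs6_of_D6 hDel F h6 V a Φ hΦ ν hν hw ℓ X ι' hX (FacePin hDel F V Φ)
    (fun Jstar Jperp B hB hpos {K₀} S eG hφ => ⟨⟨Jstar, Jperp, B, hB, hpos, eG, hφ⟩⟩)

/-- S5 CLOSED BY NAME (v15) — generic per-`f` scalar transfer up an étale tower morphism = A-p18 k19 ★ `towerRep_eq_smul_of_span_of_pull_ne_zero`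
(`Liu2021/AppendixC/OmegaHomPullback.lean`; statement = `S5Transfer`'s body token for token). [cite: Liu2021, Thm. 4.15 proof l. 2199–2213; §4.2 (FJcycle.tex l. 2166–2174; print pp. 49–50)] -/
theorem stub_S5 : S5Transfer :=
  fun Cₛ C Tₛ T φ hφ hK₀ M ℓ _ X Xₛ hX hXₛ ι _ _ _ ρW σ c f hf hspan hne hₛ =>
    towerRep_eq_smul_of_span_of_pull_ne_zero Cₛ C Tₛ T φ hφ hK₀ M ℓ X Xₛ hX hXₛ ι ρW σ c f hf hspan hne hₛ

/-- III-9′(S) DERIVED (v15; was the registered fact-level XXL stub of v12–v14, name + statement kept): [Liu 2021, Thm 4.15] proper, Frobenius form, at the face,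
from MULT1 + S34 + S5 by the kernel-checked glue `thm415FrobeniusAtFace_of_split`.  v15d: takes the route item `h413 : H413` (feeds `stub_MULT1`); conclusion unchanged.
[cite: Liu2021, Thm. 4.15 (FJcycle.tex l. 2177–2182), proof l. 2185–2213] [cite: MurtyRamakrishnan1992, Prop. 6] [cite: Carayol1986, §10.3] [cite: Rajan2000, Thm. 1] -/
theorem stub_S_thm415Frobenius (h413 : Summit.HodgeConjecture.HodgeConjecture.Theses.HCCMUnconditional.H413) : Thm415FrobeniusAtFace :=
  thm415FrobeniusAtFace_of_split (stub_MULT1 h413) stub_S34 stub_S5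

/-- III-9′(R0) CLOSED BY NAME (v12): «Frobenius-dense ⇒ all σ» for every datum = A-p12 g4 ★ `thm415Pinned_of_frobenius` (`Liu2021/AppendixC/Thm415PinnedOfFrobenius.lean`),
universally closed. [cite: Liu2021, Thm. 4.15; Def. 4.5 (2) (l. 1952); Thm. 4.18 proof (l. 2263)] [cite: SerreTate1968, §1] [cite: NeukirchANT1999, Ch. VII §13] -/
theorem stub_R0_frobeniusToPinned : R0FrobeniusToPinned := by
  intro F E _ _ _ _ _ _ _ _ P5 isotropicAt C U ℓ _ X ι μ hμ Aμ iμ hA hS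
  exact thm415Pinned_of_frobenius C U ℓ X ι μ hμ Aμ iμ hA hS

set_option synthInstance.maxHeartbeats 400000 in
set_option maxHeartbeats 8000000 in
/-- **GLUE AT THE FACE (proved): (R0) + (S) ⇒ `Thm415AtFace`.**  At the face's binders the Frobenius-form CM hypothesis of (R0) is DISCHARGED by the object `obj ∈ 𝒜(ν)`
itself: its carriers are `CarN = Carriers.ofPolDR ν _`, whose `IsCMCharacter` component IS `Def45.IsCMCharacterMuAlgHecke ν` (`Carriers.ofPolDR_isCMCharacter`, `rfl`), and
Hecke form ⇒ Frobenius form is ★ `IsCMCharacterMuAlgHecke.isCMCharacterMuAlg`. [cite: Liu2021, Thm. 4.15; Def. 4.5 (2); Thm. 4.18 proof (l. 2263)] -/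
theorem thm415AtFace_of_R0_S (hR0 : R0FrobeniusToPinned) (hS : Thm415FrobeniusAtFace) : Thm415AtFace := by
  intro hDel F _ h6 ι₁ V a Φ hΦ ν hν hw ℓ _ X ι' obj hX
  exact hR0 (CV hDel F V Φ) (UV hDel F V a Φ) ℓ X ι' ν hν
    (RestOne.AμOne (AlgHom.id ℚ _) ι₁ hν hw (CarN F ι₁ ν hν) obj) (RestOne.iOne (AlgHom.id ℚ _) ι₁ hν hw (CarN F ι₁ ν hν) obj)
    (Def45.IsCMCharacterMuAlgHecke.isCMCharacterMuAlg (RestOne.datum (AlgHom.id ℚ _) ι₁ hν hw (CarN F ι₁ ν hν) obj).isCMCharacter)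
    (hS hDel F h6 V a Φ hΦ ν hν hw ℓ X ι' hX)

end T2

/-- III-9′ DERIVED (v12): [Liu 2021, Thm 4.15] PINNED at the face (B-typ04's `Thm415Pinned` instantiated at `(ℭ_V, muConj 𝕌_V at a, ν, A_ν, i_ν)` for every induced
`X`, every `ι`, every conjugate-symplectic weight-one `ν` and every `obj ∈ 𝒜(ν)`) — from the two registered stubs III-9′(R0) and III-9′(S) by `thm415AtFace_of_R0_S`.
Name kept from v3–v11; v15d: takes the route item `h413 : H413` (MULT1 keyed on `H413`), conclusion unchanged. [cite: Liu2021, Thm 4.15 (FJcycle.tex l. 2177–2182)] [cite: MurtyRamakrishnan1992, Prop. 6] -/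
theorem stub_thm415AtFace (h413 : Summit.HodgeConjecture.HodgeConjecture.Theses.HCCMUnconditional.H413) : Thm415AtFace :=
  thm415AtFace_of_R0_S stub_R0_frobeniusToPinned (stub_S_thm415Frobenius h413)

set_option synthInstance.maxHeartbeats 400000 in
set_option maxHeartbeats 8000000 in
/-- (S) CLOSED BY NAME from the route's item `H21` and the III-6 residual — A-p18's `stubGaloisLabelSeparation_byName_of_casselman_of_thm415`
(`HypLiu418/A3Liu418LabelSeparation.lean`, over B-side `Thm418LabelSeparation.lean` `galoisLabelSeparation_of_thm415Pinned_of_casselman`): a label `μ′ ≠ ν`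
contributes no `𝔾`-intertwiner into the `ν^{alg}`-isotypic part ([Thm 4.15] at `μ′` + injectivity of `μ ↦ μ^{alg}`; `h21` = [Shimura 21.4 (Casselman)] makes
`𝒜(μ′) ≠ ∅`).  `h21 : HCCMUnconditional.H21` unfolds to `shimura1998_thm21_4_casselman` (delta). [cite: Liu2021, Thm 4.15; Thm 4.18 proof l. 2258–2266] -/
theorem stub_galoisLabelSeparation_of (h21 : Summit.HodgeConjecture.HodgeConjecture.Theses.HCCMUnconditional.H21) (h413 : Summit.HodgeConjecture.HodgeConjecture.Theses.HCCMUnconditional.H413) : StubGaloisLabelSeparation :=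
  stubGaloisLabelSeparation_byName_of_casselman_of_thm415 h21 (stub_thm415AtFace h413)

/-! ### v9: the III-11 binder-fact slots ×4 (A-p19's closed Props, `A3Liu418EpsRigidFaceTypes.lean`, INVENTORY rows III-11a–d) — each a NAMED-FACT slot retired BY NAME by its `_holds` -/

/-- **row III-11a (III-11 binder fact T) — THE LOCAL GALOIS TWIST OF A MEMBER IS A MEMBER (road pieces P3 + P4): at a non-split `v`, for two members `i₀ i₁` of `famAtV … v` with the same label `μ`, `σ ∈ Aut(ℂ ∕ M_μ)` with cyclotomic unit `κ` (`σ ∘ ψ_v = ψ_v(κ·)`), `a_{i₁} = t·a_{i₀}` with `s²t = κ`, `χ_{i₁} = σ ∘ χ_{i₀}` ⇒ a bijective `σ`-semilinear `U(J_V)(F⁺_v)`-map local type `i₀` → local type `i₁` (`X_v(μ,a,χ)^σ ≅ X_v(μ,ta,χ^σ)`).**  Named Prop `LocalTypeGaloisTwist` (A-p19, `A3Liu418EpsRigidFaceTypes.lean`); row III-11a (INVENTORY v4.1, director BATCH 64); closer B-p08 g2 `localTypeGaloisTwist_holds` (`CorCM/HypLiu418/A3Liu418LocalTypeGaloisTwist.lean`,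 director BATCH 64 (1)) over its own P3a/P3c seams ★ p609948/p610903/p610966/p611338/p611843, P3b B-p13 (p611656 (i) + main), P4 B-p14 §3.  WHY IT MIGHT FAIL: the `uniformOmegaRep` normalisation (unitary vs `|·|^{1∕2}`-twisted Siegel scalar) must be `σ`-stable — A-p19: it is, for ANY `μ`, once `σ` fixes `M_μ` (`μ^{alg} := μ·‖‖^{-1∕2}`).  SIZE: L.  Slot: `:= localTypeGaloisTwist_holds`. [cite: Liu2021, Thm. 4.18 (3) proof l. 2272–2289; Def. 4.11 l. 2092–2096] [cite: MoeglinVignerasWaldspurger1987, Chap. 2 II.1, Remarque (2)] [cite: HarrisKudlaSweet1996, §1 (1.14)–(1.15)] -/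
theorem stub_localTypeGaloisTwist : LocalTypeGaloisTwist :=
  Summit.HodgeConjecture.CorCM.Lines.A3Liu418.localTypeGaloisTwist_holds   -- v10: CLOSED BY NAME (B-p08 p618003)

/-- **row III-11b (III-11 binder fact Nodd) — THE CYCLOTOMIC UNIT IS A LOCAL NORM, ODD RESIDUE CHARACTERISTIC (road piece P6, `v ∤ 2` non-split): for `μ` conjugate symplectic of weight one and `σ ∈ Aut(ℂ ∕ M_μ)` with `σ ∘ ψ_v = ψ_v(κ·)`, `κ = x·x̄` for a unit `x` of `F_w` (inert: units are norms; ramified: `√c ∈ M_μ` + the odd local norm criterion).**  Named Prop `CyclotomicUnitIsLocalNormOdd` (A-p19, `A3Liu418EpsRigidFaceTypes.lean`); row III-11b (INVENTORY v4.1); closer A-p11 g3 adapter `Liu2021/Thm418CyclotomicUnitIsLocalNormOdd.lean` (L1 `exists_mem_fieldOfValues_sq_eq` ✓, L2 `Thm418CyclotomicSquareRoots` ✓, L3 p610811 ✓ + B-p13 p610584; assembly `cyclotomicUnitIsLocalNormOdd_holds`).  WHY IT MIGHT FAIL: only through the weight-one normalisation `HasWeight μ 1` vs the tree's `μ^{alg}`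 (the ramified case needs `√c ∈ M_μ`, which is where the weight enters).  SIZE: M.  Slot: `:= cyclotomicUnitIsLocalNormOdd_holds`.  **v9: CLOSED BY NAME** `:= cyclotomicUnitIsLocalNormOdd_holds` (A-p11 p615673). [cite: Liu2021, Thm. 4.18 (3), proof l. 2272–2279] -/
theorem stub_cyclotomicUnitIsLocalNormOdd : CyclotomicUnitIsLocalNormOdd :=
  Summit.HodgeConjecture.CorCM.HypLiu418.cyclotomicUnitIsLocalNormOdd_holds   -- v9: CLOSED BY NAME (A-p11 p615673)

/-- **row III-11c (III-11 binder fact Ndy) — THE CYCLOTOMIC UNIT IS A LOCAL NORM, DYADIC (road piece P6, `v ∣ 2` non-split): same conclusion as the odd case (Liu: Eisenstein polynomial, `d := min{2v_F(a) − 1, v_F(4)}`, the three fields `ℚ(√−1), ℚ(√2), ℚ(√−2)`, [BH06 Prop. 41.2 (2)] twice).**  Named Prop `CyclotomicUnitIsLocalNormDyadic` (A-p19, `A3Liu418EpsRigidFaceTypes.lean`); row III-11c (INVENTORY v4.1); closer A-p11 g3 modulo the local-CFT input at `2` (`QuadraticForms.HilbertSymbolNormCompatAtTwo`); lit1 caveat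 on l. 2283 for even `f(F∕ℚ₂)` recorded in `Thm418EpsRigidUnderGaloisTwist.lean` (statement unaffected).  WHY IT MIGHT FAIL: the printed dyadic sentence l. 2283 is loose for even residue degree `f(F_w∕ℚ₂)` (lit1) — the STATEMENT survives, the printed PROOF may need the Hilbert-symbol route instead.  SIZE: L.  Slot: `:= cyclotomicUnitIsLocalNormDyadic_holds`. [cite: Liu2021, Thm. 4.18 (3), proof l. 2281–2289] [cite: BushnellHenniart2006, §41.2 Prop. (2)] -/
theorem stub_cyclotomicUnitIsLocalNormDyadic : CyclotomicUnitIsLocalNormDyadic :=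
  Summit.HodgeConjecture.CorCM.HypLiu418.cyclotomicUnitIsLocalNormDyadic_holds   -- v10: CLOSED BY NAME (A-p11 g4 p618694)

/-- **row III-11d (III-11 binder fact S) — A PRESCRIBED LOCAL SQUARE CLASS OF UNITS IS GLOBALLY REPRESENTED (road piece P5): for a number field `K`, a finite place `v` and a unit `κ ∈ K_v`, there are a global `t ∈ Kˣ` and `s ∈ K_vˣ` with `s²·t = κ` (density of `K` in `K_v` + `1 + 𝔭_vᴺ ⊆ (K_vˣ)²`, Hensel).**  Named Prop `PrescribedLocalSquareClass` (A-p19, `A3Liu418EpsRigidFaceTypes.lean`); row III-11d (INVENTORY v4.1); closer A-p12 g3 `prescribedLocalSquareClass_holds` (`Literature/NumberTheory/NumberFields/…`).  WHY IT MIGHT FAIL: as a number-field fact it cannot; only a typing slip (`Valued.v κ = 1` is the unit condition in Mathlib's `adicCompletion` valuation) could.  SIZE: S.  Slot: `:= prescribedLocalSquareClass_holds`.  **v9: CLOSED BY NAME** `:= prescribedLocalSquareClass_holds` (A-p12 p612863). [cite: CasselsFrohlichANT1967, Ch. II §6, §10] -/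
theorem stub_prescribedLocalSquareClass : PrescribedLocalSquareClass :=
  Summit.HodgeConjecture.CorCM.Lines.A3Liu418.prescribedLocalSquareClass_holds   -- v9: CLOSED BY NAME (A-p12 p612863)

set_option synthInstance.maxHeartbeats 400000 in
set_option maxHeartbeats 8000000 in
/-- RESIDUAL (A-side, v5 proposal by A-p19; **v8: typed as the named face Prop `EpsRigidAtFace`** of A-p18 p608544, same Expr): ε-RIGIDITY UNDER GALOIS TWIST at `V`'s own relabelled one-object rest `D₀ = toThm418Data ℭ_V ((muConj 𝕌_V).rest t_ν)`
(row III-11 (G2), B-typ04's named fact ✔ `Thm418Data.EpsRigidUnderGaloisTwist` p600012, instantiated at the face; [Liu2021, Thm 4.18 (3) proof l. 2272–2290] +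
[BH06 §41.2 (2)] + [Lem D.1 (3)]).  WHY IT MIGHT FAIL: the tree's `uniformOmegaRep` normalisation (unitary vs `|·|^{1∕2}`-twisted splitting). SIZE: L (A-IV-adjacent).
**v9: DERIVED** from the four binder facts by A-p19's `epsRigidAtFace_of_localTwist` (★ p614667) — no longer a registered `sorry`.
[cite: Liu2021, Thm. 4.18 (3) proof (FJcycle.tex l. 2272–2290); App. D Lem. D.1 (3)] [cite: BushnellHenniart2006, §41.2 (2)] -/
theorem stub_epsRigidAtFace : EpsRigidAtFace :=
  epsRigidAtFace_of_localTwist stub_localTypeGaloisTwist stub_cyclotomicUnitIsLocalNormOdd stub_cyclotomicUnitIsLocalNormDyadic stub_prescribedLocalSquareClass   -- v9: DERIVED (A-p19 p614667)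

/-- `stub_mainGaloisGlue` CLOSED BY NAME (A-p19 `stub_mainGaloisGlue_of`, `HypLiu418/A3Liu418MainGaloisGlue.lean`) modulo `h21` and the residual `stub_epsRigidAtFace`.
[cite: Liu2021, Thm 4.18 proof (FJcycle.tex l. 2245–2290)] -/
theorem stub_mainGaloisGlue : Summit.HodgeConjecture.HodgeConjecture.Theses.HCCMUnconditional.H21 → StubMainGaloisGlue := fun h21 =>
  stub_mainGaloisGlue_of h21 stub_epsRigidAtFace

set_option synthInstance.maxHeartbeats 400000 in
set_option maxHeartbeats 8000000 in
/-- **`stub_mainGalois_of`** (v3 proof, v4 binder `hΦ`): MAIN + (3) from the five ℓ-adic pieces, [Thm 4.15], [Def 4.11] and item (2), pointwise in the face prefix.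
[cite: Liu2021, Thm 4.18 proof l. 2245–2272] -/
theorem stub_mainGalois_of (hEB : StubEtaleBettiModel) (hF : StubFaltingsIsotypic) (hS : StubGaloisLabelSeparation)
    (hG : StubMainGaloisGlue) (h415 : Thm415AtFace) (h411 : Hyp411) (hN : StubNonIso) : StubMainGalois := by
  intro hDel F _ h6 ι₁ V a Φ hΦ ν hν hw Φ' hSI
  refine hG h411 hDel F h6 V a Φ hΦ ν hν hw Φ' hSI ?_ (hN hDel F h6 V a Φ hΦ ν hν hw Φ')
  intro ℓ _ ι'
  obtain ⟨X, hX, hB⟩ := hEB hDel F h6 V a Φ hΦ ℓ ι'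
  exact ⟨X, hX, hB, hF hDel F h6 V a Φ hΦ ν hν hw ℓ X ι' hX, fun obj => h415 hDel F h6 V a Φ hΦ ν hν hw ℓ X ι' obj hX,
    hS hDel F h6 V a Φ hΦ ν hν hw ℓ X ι' hX⟩

set_option synthInstance.maxHeartbeats 400000 in
set_option maxHeartbeats 8000000 in
/-- (N) CLOSED BY NAME from the route's item `HD3` and the CLOSED item `HD1pp` — A-p08's `stubNonIso_of_hypD3_hypD1pp` (`HypLiu418/A3Liu418NonIso.lean`): item (2) of
[Thm 4.18] at `D′` from [Lem D.1 (3)] (`hD3`) and [Lem D.1 (1)] (`Theorems.HD1pp_proof`, B-p01 p603347) by local–global transport.  `hD3 : HCCMUnconditional.HD3` and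
`HD1pp_proof : HCCMUnconditional.HD1pp` unfold to the pack decls `HypD3` ∕ `HypD1pp` (delta), whose bodies are A-p08's hypothesis types character for character.
[cite: Liu2021, Thm. 4.18 (2); App. D Lem. D.1 (1), (3)] -/
theorem stub_nonIso_of (hD3 : Summit.HodgeConjecture.HodgeConjecture.Theses.HCCMUnconditional.HD3) : StubNonIso :=
  stubNonIso_of_hypD3_hypD1pp hD3 Summit.HodgeConjecture.HodgeConjecture.Theorems.HD1pp_proof

/-! ## Composition (real proof, v4): the gate-shape head concludes the route decl `HCCMUnconditional.HLiu418` BY NAME from the route's items `H21`, `H413`, `HD3` -/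

set_option synthInstance.maxHeartbeats 400000 in
set_option maxHeartbeats 8000000 in
/-- **`HLiu418_proof`** (v4 HEAD, gate shape): the route item `HLiu418` = `PrintedCitationHypotheses.HypLiu418` ([Liu 2021, Thm 4.18] AS PRINTED at the conjugate
space's transported datum, for every `hDel`) from the route's items `H21` ([Shimura 21.4], via (S) and (G)), `H413` ([Prop 4.13] at the pin, via P at place and off
place) and `HD3` ([Lem D.1 (3)], via (N)), the CLOSED items `H411` ∕ `HD1pp` by their theorems, the by-name slots (I)(D)(F)(P-at)(S)(N) and the seven registered
`sorry`s (five fact-level: III-0, I-4, VI-1, VI-2″, III-6; two A-side: off-place P, G).  Items (1), main + (3), (2) are assembled AS PRINTED at `D′` by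
`thm418AsPrinted_of_items`.  HC_CM is proved only modulo the 7 printed citations until rung 0 closes. [cite: Liu2021, Thm 4.18] -/
theorem HLiu418_proof (h21 : Summit.HodgeConjecture.HodgeConjecture.Theses.HCCMUnconditional.H21) (h413 : Summit.HodgeConjecture.HodgeConjecture.Theses.HCCMUnconditional.H413) (hD3 : Summit.HodgeConjecture.HodgeConjecture.Theses.HCCMUnconditional.HD3) : Summit.HodgeConjecture.HodgeConjecture.Theses.HCCMUnconditional.HLiu418 := by
  intro hDel F _ h6 ι₁ V a Φ hΦ ν hν hw R' hR' Φ'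
  have hP : StubBettiThetaModel :=
    stub_bettiThetaModel_of (stub_bettiThetaModelAtPlace_of h413 stub_pinBettiPinning)
      (stub_bettiThetaModel_offPlace h413 stub_canonicalModel_unique_printed)
  have s2 : StubNonIso := stub_nonIso_of hD3
  exact thm418AsPrinted_of_items _
    (stub_mainGalois_of (stub_etaleBettiModel_of hP stub_etaleComparisonAtFace) (stub_faltingsIsotypic h413) (stub_galoisLabelSeparation_of h21 h413)
      (stub_mainGaloisGlue h21) (stub_thm415AtFace h413) Summit.HodgeConjecture.HodgeConjecture.Theorems.H411_proof s2 hDel F h6 V a Φ hΦ ν hν hw Φ' ⟨R', hR'⟩)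
    (stub_levelInvariants_of stub_albTransitionEpi stub_honestIsogenyDescent hDel F h6 V a Φ hΦ ν hν hw Φ') (s2 hDel F h6 V a Φ hΦ ν hν hw Φ')

set_option synthInstance.maxHeartbeats 400000 in
set_option maxHeartbeats 8000000 in
/-- AUDIT (v4, kernel): fed into the route's deciding theorem `HCCMUnconditional.closes` together with the CLOSED items' theorems, this line leaves exactly the items
`HDel`, `H21`, `H413`, `HD3` as hypotheses of `CMAbelianHodge` (= HC_CM).  HC_CM is proved only modulo the 7 printed citations until rung 0 closes. [cite: Liu2021, Thm 4.18] -/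
example (hDel : Summit.HodgeConjecture.HodgeConjecture.Theses.HCCMUnconditional.HDel) (h21 : Summit.HodgeConjecture.HodgeConjecture.Theses.HCCMUnconditional.H21) (h413 : Summit.HodgeConjecture.HodgeConjecture.Theses.HCCMUnconditional.H413) (hD3 : Summit.HodgeConjecture.HodgeConjecture.Theses.HCCMUnconditional.HD3) :
    Summit.HodgeConjecture.HodgeConjecture.Theses.RankFourFaces.CMAbelianHodge :=
  Summit.HodgeConjecture.HodgeConjecture.Theses.HCCMUnconditional.closes hDel h21 (HLiu418_proof h21 h413 hD3) h413 Summit.HodgeConjecture.HodgeConjecture.Theorems.H411_proof hD3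
    Summit.HodgeConjecture.HodgeConjecture.Theorems.HD1pp_proof

end Summit.HodgeConjecture.CorCM.Lines.A3Liu418

end
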